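import Literature.Analysis.FunctionSpaces.Complexify
import Literature.Analysis.FunctionSpaces.FlatTorus
import Literature.Analysis.FunctionSpaces.TorusCalculus
import Literature.Analysis.FunctionSpaces.TorusSobolevNorm
import Literature.Analysis.FunctionSpaces.TorusFluidGlue
import Literature.Analysis.FunctionSpaces.HolderNorm
import HarnessLib

/-!
# Barrier (AnomalousDissipation): Onsager flexibility is Euler-side — convex integration reaches
Navier–Stokes only through non-Leray weak solutions
(D-0021 barrier catalogue for `Summits/AnomalousDissipation`; summit statement
`AnomalousDissipation := Literature.Turb.ZerothLaw`; seed barrier "Onsager threshold results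
(Isett; BDLSV) are about Euler, not forced NS")

The flexible side of Onsager's conjecture (Isett, Ann. Math. 188 (2018), Thm. 1;
Buckmaster–De Lellis–Székelyhidi–Vicol, CPAM 72 (2019), Thm. 1.1 — accepted as
`Literature.Analysis.FluidPDE.onsager_flexibility`) produces dissipative *Euler* solutions in `C^β_{t,x}`, `β < 1/3`.
What convex integration transfers to Navier–Stokes is Buckmaster–Vicol, Ann. Math. 189 (2019),
Thm. 1.3: every Hölder continuous weak Euler solution is a strong `C⁰_t L²_x` limit, as `ν → 0`,
of *weak* (mild/Oseen, `C⁰_t H^β_x`) solutions of Navier–Stokes, obtained by a proof "closely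
related" to that of the non-uniqueness theorem (op. cit. Thm. 1.2), of whose solutions the
authors write: "at the moment we do not prove that they are Leray-Hopf weak solutions, i.e.,
they do not obey the energy inequality or have `L²_t Ḣ¹_x` integrability. Moreover, the
regularity parameter `β > 0` cannot be expected to be too large, since at `β = 1/2` one has
weak-strong uniqueness" (op. cit. §1.2) — whereas `ZerothLaw` quantifies over Leray–Hopf
solutions. "Whether similar vanishing viscosity results hold for sequences of Leray-Hopf weak
solutions, or for suitable weak solutions of (NSE), remains a challenging open problem"
(op. cit. §1.2, after Thm. 1.3); the summit itself is posed as an open problem in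
Buckmaster–Vicol, EMS Surv. Math. Sci. 6 (2020), §8 (last problem), and Bruè–De Lellis, CMP 400
(2023), §2 record that "most of the dissipative solutions produced by these methods cannot
arise as vanishing viscosity limits of Leray solutions" (before Question 2.4; arXiv numbering:
Question 4). No printed theorem excludes a Leray–Hopf (or classical) vanishing-viscosity
realisation of a *dissipative* convex-integration solution: the obstruction catalogued here is the
documented gap between the printed reach of the technique and the class the summit quantifies
over. (For energy-gaining flows the exclusion is elementary — the Leray–Hopf energy inequalities
pass to `C⁰_t L²` limits — and is the narrowed companion
`ConvexIntegrationNonLerayEnergyCeilingNarrow` of the sibling file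
`ConvexIntegrationNonLerayEnergyCeiling`, re-audit 2026-08-17; the dissipation a realisation can
transmit is capped by the realised flow's energy drop, `ConvexIntegrationNonLerayDissipationBudgetNarrow`
of `ConvexIntegrationNonLerayDissipationBudget`, generation 2; and the fidelity of a realisation is
capped by its enstrophy budget — Buckmaster–Vicol 2020, Rem. 6.4, as a theorem about every
Leray–Hopf solution — `ConvexIntegrationNonLerayResolutionNarrow` of
`ConvexIntegrationNonLerayResolution`, generation 3; generation 4 confirms the Navier–Stokes-side
frontier at page level — the unreached class is exactly `L²_t H¹` with the a.e.-time energy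
inequality, Cheskidov–Zeng–Zhang, arXiv:2503.05692, p. 2; Cheskidov–Luo, Invent. Math. 229 (2022),
Thm. 1.7 — and files no further narrowing, caveats (k)–(l); generation 5 confirms again —
technique-class coverage and hypothesis class re-checked at page level — and proves caveat (l),
the vacuity of realisation below `L²_t` strength, as the theorem `weakNS_realisation_LpLinfty` of
the sibling file `ConvexIntegrationNonLerayWeakModes`, caveats (m)–(r); generation 6 confirms and
bounds the SCOPE of the block on the side of the summit: its `because:` clauses are Cauchy-problem
clauses, void for STEADY (and smooth time-periodic) witnesses, whose Leray–Hopf membership is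
automatic and whose Euler-side objects — bounded steady Euler flows absorbing positive power from a
steady force — the forced stationary h-principle supplies as a tree theorem; for them the block
documents only that the steady same-force realisation is open, caveats (s)–(t); generation 9 narrows the block on
the FORCE axis: with `ν`-dependent forces `div R_n`, `sup |R_n| → 0` (vanishing in `C⁰_t W^{-1,∞}`),
the Leray–Hopf — indeed classical — realisation of EVERY Hölder weak Euler flow is a tree theorem,
`BuckmasterVicol2019_thm13_lerayHopf_smallForce` of the sibling file
`ConvexIntegrationNonLerayForceTopology`, so the open realisation problem is the one with the SAME
force or with forces converging in `L¹_t L²_x`, caveats (x)–(y); generation 10 confirms — the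
fact re-verified as a kernel theorem, the `L²_t H¹` frontier of the technique re-derived from the
schemes' own bookkeeping (the energy class is pinned half a derivative beyond the `H^{1/2-}` cap of
one-step cascades, in every dimension and for every intermittency), and the live class of the open
realisation shown to be MEAGRE among flexible flows: the Baire-typical Hölder weak Euler flow has
kinetic energy of unbounded variation on every time interval — De Rosa–Tione, Anal. PDE 15 (2022),
Thm. 1.2 — and is excluded by the energy ceiling (e), caveats (z)–(bb); generation 11 confirms and
sharpens two edges of the scope: on the HYPOTHESIS side the printed weak realisation is for Hölder
flows, so the intermittent dissipative flows of Novack–Vicol and Giri–Kwon–Novack — the least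
constrained targets of (q) — lack even the Oseen-class realisation in print, and on the FORCE axis
zero-net-work `ν`-dependent correctors transmitting the full anomaly are free for every strictly
dissipative Hölder flow, so only `L²`-strength control of the force is informative, caveats
(cc)–(ee); generation 12 confirms — the fact re-verified as a kernel theorem, the Onsager-theory and
regularisation-by-noise literatures read at page level for a SELECTION-side exclusion of convex-integration
flows from Leray–Hopf realisation (none is a theorem: the selection problem of the inviscid limit is open,
and Eulerian spontaneous stochasticity concerns the same-datum or generic-data limit, not the existential
realisation barred here), the free realisation of (x) placed on the Sobolev force scale (forces vanishing in
`C⁰_t H^{-s}_x` for every `s > 1 - 2β̄`), literature to 2026-08 unchanged, caveats (ff)–(gg); generation 15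
confirms and records the free CONVERSE of the open realisation: every classical Navier–Stokes flow is a
smooth strict Euler subsolution with the viscous stress as Reynolds stress — Buckmaster–De Lellis–
Székelyhidi–Vicol, CPAM 72 (2019), Def. 1.2 and Thm. 1.3 — hence shadowed in `C⁰_t L²`, to accuracy
`O((ν sup_t ‖∇v(t)‖_{L¹})^{1/2})`, by exact `C^{1/3-}` convex-integration flows with the same force and
equal dissipation, so that what is open is the prescribed, compact direction only and bare Euler-side
existence cruxes are never load-bearing, caveat (hh).)

## What is vendored

* `BuckmasterVicol2019_thm13` — Thm. 1.3 as printed, on the flat unit torus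
  `T³ = UnitAddTorus (Fin 3)` with the accepted notions `Torus.IsWeakEulerSolutionOn`,
  `Torus.IsWeakNSSolutionOn` (BV Def. 1.1 without mean zero, restored as a conjunct, exactly as
  in the accepted `Literature.Analysis.FluidPDE.buckmasterVicol_nonuniqueness`), `Torus.ContinuousInSobolevOn` /
  `Torus.eSobolevNorm` (`C⁰_t H^β_x`, spectral, complexified field) and the accepted space–time
  Hölder class `Literature.Analysis.FunctionSpaces.HolderOnSpaceTime` (`Literature.Analysis.FunctionSpaces.HolderNorm`, the
  class of `Literature.Analysis.FluidPDE.onsager_flexibility`) for `u ∈ C^β̄(T³ × [-2T,2T])`. The Euler solution is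
  given on `[-2T, 2T]` as printed; both the Hölder class and "weak solution of Euler on
  `(-2T,2T)`" are expressed through the time-shifted field `t ↦ u (t - 2T)` on `[0, 4T]`
  (the accepted predicates live on `[0,T']` / `(0,T')`).
* The barrier docstring block sits on `BuckmasterVicol2019_thm13`.

## References

* T. Buckmaster, V. Vicol, Ann. of Math. 189 (2019), Def. 1.1, Thm. 1.2, Thm. 1.3, §1.2.
* T. Buckmaster, V. Vicol, EMS Surv. Math. Sci. 6 (2020), Thm. 3.10 (restatement of Thm. 1.3), Rem. 6.4,
  §8 (last problem).
* P. Isett, Ann. of Math. 188 (2018), Thm. 1; T. Buckmaster, C. De Lellis, L. Székelyhidi,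
  V. Vicol, Comm. Pure Appl. Math. 72 (2019), Thm. 1.1.
* E. Bruè, C. De Lellis, Comm. Math. Phys. 400 (2023), §2.
* T. D. Drivas, T. M. Elgindi, G. Iyer, I.-J. Jeong, ARMA 243 (2022), §5 (closing remarks).
* M. Dai, SIAM J. Math. Anal. 53 (2021), Thms. 1.1–1.2 (arXiv:1812.11311); M. Colombo, L. De Rosa,
  SIAM J. Math. Anal. 52 (2020), Thm. 1.1; M. Colombo, L. De Rosa, M. Sorella, arXiv:2102.03244,
  Thm. 1.1; G. Sattig, L. Székelyhidi, Acta Math. Hungar. (2023), Thm. 5 (generation-5 audit).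
* A. Choffrut, L. Székelyhidi, SIAM J. Math. Anal. 46 (2014), Thm. 1 (arXiv:1401.4301, p. 3);
  A. Huang, J. Math. Anal. Appl. 544 (2025) 129098, Thm. 1.1(a) (arXiv:2405.08390, p. 3); A. Enciso,
  J. Peñafiel-Tomás, D. Peralta-Salas, arXiv:2501.13632, Thm. 1.1; X. Luo, ARMA 233 (2019),
  Thms. 1.4, 1.7 and p. 5 (arXiv:1807.09318); P. Constantin, A. Tarfulea, V. Vicol, ARMA 212 (2014),
  pp. 3, 6 of arXiv:1305.7089; R. Temam, *Navier–Stokes Equations* (1979), Ch. II §1, Thm. 1.2,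
  (1.21)–(1.22), Prop. 1.1 (generation-6 audit: the steady branch).
* L. De Rosa, R. Tione, Anal. PDE 15 (2022), 405–428, Thms. 1.2–1.3 (arXiv:1908.03529, pp. 3–4);
  D. Albritton, M. Colombo, G. Mescolini, arXiv:2507.19257, Thm. 1.1 (generation-10 audit:
  genericity; same-force realisation of instability-generated non-uniqueness in two dimensions).
* M. Novack, V. Vicol, Invent. Math. 233 (2023), Thm. 1.1 (arXiv:2203.13115, p. 4); V. Giri, H. Kwon,
  M. Novack, Ann. of Math. 204 (2026), Thm. 1.1 (arXiv:2305.18509, p. 3); W. S. Ożański, Comm. Math. Phys.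
  374 (2020), Thm. 1.3 (arXiv:1809.02109, p. 4); P. Korn, arXiv:2605.13048, abstract; A. Cheskidov, X. Luo,
  SIAM J. Math. Anal. 53 (2021), Thms. 1.4, 1.6 (arXiv:1910.04204) (generation-11 audit: hypothesis class of the
  weak realisation; flexibility of the Navier–Stokes inequality; numerical-conservation selection; fixed-`ν`
  anomalous work).
* G. L. Eyink, J. Fluid Mech. 988 (2024), P1, §3.2.2–§3.2.3 (pp. 40–42); F. Flandoli, M. Rehmeier, Milan J.
  Math. 92 (2024), 349–370, §2.3 (arXiv:2402.16525); D. Bandak, A. A. Mailybaev, G. L. Eyink, N. Goldenfeld,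
  Phys. Rev. Lett. 132 (2024), 104002; S. Thalabard, J. Bec, A. A. Mailybaev, Commun. Phys. 3 (2020), 122
  (generation-12 audit: the selection side of the inviscid limit; the Sobolev force scale of the free realisation).
-/

open MeasureTheory Set Filter Topology
open scoped ENNReal NNReal

noncomputable section

namespace Literature.Barriers.AnomalousDissipation

/-- The flat three-torus `T³ = (ℝ/ℤ)³` (local notation). -/
local notation "𝕋³" => UnitAddTorus (Fin 3)
/-- Velocity values (local notation). -/
local notation "E³" => EuclideanSpace ℝ (Fin 3)

/-- **Dissipative Euler solutions arise in the vanishing viscosity limit of *weak* Navier–Stokes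
solutions** (Buckmaster–Vicol, Ann. of Math. 189 (2019), Thm. 1.3; EMS Surv. 6 (2020),
Thm. 3.10). For `β̄ > 0` let `u ∈ C^{β̄}_{t,x}(T³ × [-2T,2T])` be a zero-mean weak solution of the
Euler equations. Then there exist `β > 0`, a sequence `ν_n → 0` (`ν_n > 0`) and a sequence
`v^{(ν_n)}` of weak solutions of the Navier–Stokes equations with viscosity `ν_n` on
`T³ × (0,T)` (BV Def. 1.1: distributional, `L²`, weakly divergence free, mean zero), uniformly
bounded in `C⁰([0,T]; H^β(T³))`, with `v^{(ν_n)} → u` strongly in `C⁰([0,T]; L²(T³))`.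
Of the solutions of the closely related Thm. 1.2 the authors note: "at the moment we do not prove
that they are Leray-Hopf weak solutions … the regularity parameter `β > 0` cannot be expected to
be too large, since at `β = 1/2` one has weak-strong uniqueness" (op. cit. §1.2), and after
Thm. 1.3: "Whether similar vanishing viscosity results hold for sequences of Leray-Hopf weak
solutions, or for suitable weak solutions of (NSE), remains a challenging open problem." 

BARRIER (D-0021):
- technique_class: convex-integration h-principle onsager-flexibility intermittent-convex-integration wild-solutions
- blocks: transfer of the Onsager-flexibility constructions (Isett 2018 Thm. 1, BDLSV 2019 Thm. 1.1: `Literature.Analysis.FluidPDE.onsager_flexibility`; and this theorem) into a witness for `Literature.Turb.ZerothLaw` = `AnomalousDissipation`, which quantifies over Leray–Hopf solutions `Torus.IsGlobalLerayHopf` of steadily forced Navier–Stokes, and more generally the vanishing-viscosity realisation of convex-integration Euler solutions by Leray–Hopf or classical Navier–Stokes solutions (route EulerLimit, crux VanishingViscosityRealization): the printed reach of the technique on the Navier–Stokes side is the class of weak (Oseen) solutions of BV Def. 1.1 [cite: BuckmasterVicol2019Annals, Thm. 1.3 and §1.2] (restated as [cite: BuckmasterVicol2020, Thm. 3.10]),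 and for Leray–Hopf or suitable weak solutions the realisation "remains a challenging open problem" [cite: BuckmasterVicol2019Annals, §1.2]; the summit is posed as open in [cite: BuckmasterVicol2020, §8, last problem].
- because: for the solutions constructed by the intermittent convex-integration scheme (Thm. 1.2, whose proof is "closely related" to that of Thm. 1.3) "at the moment we do not prove that they are Leray-Hopf weak solutions, i.e., they do not obey the energy inequality or have `L²_t Ḣ¹_x` integrability. Moreover, the regularity parameter `β > 0` cannot be expected to be too large, since at `β = 1/2` one has weak-strong uniqueness" [cite: BuckmasterVicol2019Annals, §1.2]; "most of the dissipative solutions produced by these methods cannot arise as vanishing viscosity limits of Leray solutions of Navier–Stokes … even showing that some solution produced by convex integration is the limit of a classical vanishing viscosity approximation is a widely open problem" [cite: BrueDeLellis2023, §2]; "none of these constructions are achieved as zero viscosity limits of Navier–Stokes solutions obeying a physical energy balance (e.g. Leray–Hopf weak solutions)" [cite: DrivasEtAl2022, §5]; for smooth forced Navier–Stokes approximants of a `C^β` convex-integration solution (`β < 1/3`, forces `f^ν = div F^ν → 0`) the work of the force is `≈ ν^{(3β-1)/(1+β)}`, unbounded as `ν → 0` [cite: BuckmasterVicol2020, Rem.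 6.4]; Hölder-class schemes that absorb the dissipative term into the stress are "possible only by using building blocks which are sparse in the frequency variable and for small fractional powers of the Laplacian" [cite: BuckmasterVicol2019Annals, §1].
- evasions_known: none published for Leray–Hopf solutions with a `ν`-independent smooth steady force (the summit is stated as an open problem in [cite: BuckmasterVicol2020, §8] and [cite: BrueDeLellis2023, §2 Questions 2.1–2.2]); anomalous dissipation for classical solutions has been obtained by other mechanisms with `ν`-dependent forces: `2½`-dimensional flows plus scalar mixing, forces uniformly in `C⁰_t C^α_x` (`α < 1`) [cite: BrueDeLellis2023, Thm. 1.1] (`Literature.Analysis.FluidPDE.brue_deLellis_anomalous_dissipation`), Onsager-critical families uniformly in `L³_t C^{1/3-ε}_x` [cite: BCCDS2024, Thm. 1.1] (`Literature.Analysis.FluidPDE.bccds_onsager_critical`), and long-time averages of smooth time-periodic solutions with forces `f^ν → f` [cite: arXiv231104182, Thm. 1.3] (`Literature.Analysis.FluidPDE.cheskidov_time_periodic_anomaly`); in the neighbouring hypodissipative models `(-Δ)^γ` the technique does reach the Leray–Hopf class — infinitely many Leray–Hopf solutions for `γ < 1/5` [cite: ColomboDelellisDerosa2018, Thm. 1.2]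 and `γ < 1/3` [cite: Derosa2018, Thm. 1.2], and, the Leray–Hopf analogue of the vendored Thm. 1.3 for the flows of the construction — existential in the Euler flow ("There exist dissipative solutions `v ∈ C^{β'}([0,T] × T³)` of Euler such that, if `0 < γ < β'`, there exists a sequence `ν_n → 0` and a sequence `v^{(ν_n)}` of Leray-Hopf weak solutions … such that `v^{(ν_n)} → v` strongly in `C⁰([0,T], C^{β''}(T³))`", p. 4 of arXiv:1801.10235), whereas Thm. 1.3 realises EVERY Hölder weak Euler flow — some dissipative `C^{β'}` Euler flows (`β' < 1/3`) that are strong `C⁰_t C^{β''}_x` limits of Leray–Hopf solutions of the `γ`-hypodissipative equations whenever `0 < γ < β'` [cite: Derosa2018, Thm. 1.3] (there the convex-integration flow itself lies in `L²_t H^γ_x` and `ν(-Δ)^γ v_q` is of stress size; the condition `γ < β'` has no `γ = 1` instance, so this is a statement about the dissipation order, not an evasion for Navier–Stokes).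
- scope_caveats: the seed folklore ("Onsager-threshold results are about Euler; convex integration cannot reach forced Navier–Stokes") over-claims relative to print — BV 2019 Thm. 1.3 does reach Navier–Stokes, in the weak (Oseen) class, and nothing printed rules out a Leray–Hopf, suitable or classical vanishing-viscosity realisation of a convex-integration solution: that is open [cite: BuckmasterVicol2019Annals, §1.2] [cite: BrueDeLellis2023, §2]; hence the vendored fact, a positive existence theorem, blocks nothing formally even when discharged — the barrier is the documented gap, not a no-go theorem; unforced equations on `T³` (BV take `ν ∈ (0,1]`), forcing entering only through [cite: BuckmasterVicol2020, Rem. 6.4]; (re-audit 2026-08-15) (a) the Navier–Stokes-side reach of convex-integration-derived schemes has since grown without touching the Leray–Hopf class: two distinct global solutions, smooth for `t > 0`, from one `BMO^{-1}(T³)` datum [cite: CoiculescuPalasek2025, Thm. 1.2], outside the Leray–Hopf class only because the datum has infinite energy [cite: CoiculescuPalasek2025, Rem. 1.5], and, branching from any classical solution at any time `T_*`, weak solutions with `u(t) ∈ C^∞` at every time and Type-I growth from the right [cite: CheskidovDaiPalasek2025, Thm. 1.1 and Thm. 1.6], excluded from the Leray–Hopf class by their energy gain ("an instantaneous blow-up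 can occur in the Leray–Hopf class only after the appearance of a finite-time blow-up") [cite: CheskidovDaiPalasek2025, §1.2] — both make the solution exact by a heat-dominated (parabolic) fixed point with only finitely many scales active at each positive time, instead of iterating to infinitely many scales active at all times, so for them the Leray–Hopf class is missed through the energy budget (infinite-energy datum, resp. energy gain at `T_*`), not through spatial roughness; convex integration proper "is only known to be applicable in settings where the solution space has flexibility, … nor (one might expect) for Leray–Hopf solutions, which exhibit weak-strong uniqueness" [cite: CoiculescuPalasek2025, §1.2.1]; Leray–Hopf non-uniqueness itself has been reached only along the Jia–Šverák programme (forced [cite: AlbrittonBrueColombo2022AnnMath, Thm. 1.2]; unforced, computer-assisted [cite: HouWangYang2025, §1]), never by convex integration; (b) the Euler-side status is unchanged through 2025: convex-integration flows "are still not known to arise as vanishing-viscosity limits of physical Navier–Stokes solutions" [cite: CheskidovPeng2025, §1 and Rem. 1.5], "in any reasonable regularity class" [cite: CheskidovDaiPalasek2025, §1.4.1]; (c) the divergence of the force's work in [cite: BuckmasterVicol2020, Rem. 6.4] belongs to the calibration used there (`‖F^ν‖_{C⁰} ≲ ν^{2β/(1+β)}`, i.e. `ν ≈ λ_q^{-(1+β)}`: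 Reynolds number `≈ 1` at the cutoff with the `C^β` bound saturated): along the same smooth iterates `v_q` the choice `ν_q := ε₀/‖∇v_q‖²_{L²_{t,x}}` (still `ν_q → 0`, since a dissipative limit is not in `L^∞ ∩ L²_t H¹_x`) gives forced Navier–Stokes solutions with `F^ν → 0` in `L²_{t,x}`, bounded work and viscous dissipation exactly `ε₀` — in either calibration the force `div(R̊_q - ν∇v_q)` acts at the viscous scale and supplies the whole viscous dissipation itself, is `ν`- and time-dependent and unbounded in `C⁰`, so such approximants bear on the summit through the force's quality, not through the size of its work (audit computation, not printed); (re-audit 2026-08-17, of the proof file `ConvexIntegrationNonLerayProofs`) (d) both named facts of the proof file are now theorems of the tree — `BuckmasterVicol2019_iterationFromLevel_holds` (by the jet scheme of [cite: BuckmasterVicol2020, §7], files `Analysis/FluidPDE/Jet*`) and `BuckmasterVicol2019_mollifiedEulerStart_holds` — so `BuckmasterVicol2019_thm13_holds` closes this vendored fact with axioms `propext`, `Classical.choice`, `Quot.sound`; the transcription was re-read against the held text [cite: BuckmasterVicol2019Annals, Thm. 1.3, Prop. 2.1, §2.4 (2.9)–(2.10), §2.5 (2.11)–(2.15), (4.16),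 Lemma 6.1] (arXiv pp. 4–6, 11, 20; two benign misprints in §2.5: `δ_n/2` for `δ_{n+1}/2` in the profile, recorded in the proof file's reading (2), and the sign of the exponent in the display (2.15), `λ_n^{β̄-β'}` for `λ_n^{β'-β̄}`); (e) the clause "nothing printed rules out a Leray–Hopf … realisation of a convex-integration solution" is exact for DISSIPATIVE flows only: in the `C⁰_t L²` mode of Thm. 1.3, limits of unforced Leray–Hopf solutions (any `ν_n`, any data) have `t ↦ ‖u(t)‖_{L²}` non-increasing on `[0,T]`, because the energy inequalities from `0` and from a.e. `s` [cite: Leray1934, §III] have zero work term and pass to the limit — theorem `ConvexIntegrationNonLerayEnergyCeilingNarrow_holds` of the sibling file `ConvexIntegrationNonLerayEnergyCeiling` — which formally excludes every energy-gaining flexibility flow (prescribed non-monotone profiles [cite: BDLSV2019, Thm. 1.1]; the compactly time-supported flows of [cite: Isett2018, Thm. 1]) although Thm. 1.3 realises all of them by weak solutions; for suitable or Leray approximants converging strongly in `L³_{t,x}` the limit satisfies moreover the local energy inequality `D(u) ≥ 0` [cite: DuchonRobert2000, Prop. 4] [cite: GiriKwonNovack2026, p. 3], so the live class of the gap is the globally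 dissipative one, populated by convex integration in `C^{1/15-}` [cite: Isett2022, Thm. 1], `C^{1/7-}` [cite: DelellisKwon2022, Thm. 1.1] and `C⁰_t(B^β_{3,∞} ∩ L^{1/(1-3β)})`, `β < 1/3` [cite: GiriKwonNovack2026, Thm. 1.1] (the cruxes of route EulerLimit already carry `D ≥ 0`); (f) literature to 2026-06 unchanged on the Navier–Stokes side: Leray–Hopf non-uniqueness proceeds by unstable self-similar profiles (numerical profiles in the axisymmetric swirl-free class [cite: IonescuJiaPalasek2026, §1.1 Conjecture 1.1]), convex-integration-derived schemes stay outside the Leray–Hopf class (`BMO^{-1}` data on `T²` [cite: MiaoNieYeBMO2026, §1]; critical Besov non-uniqueness of mild solutions on `ℝⁿ` from zero data [cite: Fujii2026, Thm. 1.2]), and the Leray–Hopf class is reached by the technique only for weaker dissipations (fractional, stochastic power-law fluids [cite: LangeRehmeierSchenke2024, §1] [cite: Berkemeier2026, §1]); (re-audit 2026-08-17, generation 2, of the proof file) (g) the transfer barred in `blocks:` is now quantified by the second narrowed companion `ConvexIntegrationNonLerayDissipationBudgetNarrow` (sibling file `ConvexIntegrationNonLerayDissipationBudget`, theorem `ConvexIntegrationNonLerayDissipationBudgetNarrow_holds`):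 along ANY Leray–Hopf realisation in the `C⁰_t L²` mode of Thm. 1.3 with `L²`-convergent data the dissipation `ν_n ∫₀ᵀ ‖∇v_n‖₂²` is eventually `≤ E(u(0)) - E(u(T)) + δ` (plus the limiting work `lim_n ∫₀ᵀ (f_n, v_n)` when forced, `lerayHopfLimit_dissipation_le`), the Leray–Hopf energy inequality from `0` [cite: Leray1934, §III (5.2)] passing to the limit through the convergence of both energies — the `T³` reading of `D ≤ ‖u_in‖² - ‖u(t)‖² + W` [cite: Cheskidov2023, §1.1] [cite: CheskidovPeng2025, §1 (1.9)]; hence energy-conservative flexible flows (constant prescribed profiles in [cite: BDLSV2019, Thm. 1.1], every `C^{1/3+}` flow [cite: ConstantinETiti1994, p. 207]) would transmit NO anomaly even if the open realisation existed for them (`lerayHopfLimit_dissipation_tendsto_zero_of_conservative`; no regularity assumed on the approximants, unlike [cite: BrenierDeLellisSzekelyhidi2011, Cor. 1]), and an Euler-limit witness of the summit must realise a STRICTLY dissipative flow, harvesting at most its designed energy loss per unit time; (h) literature re-searched to 2026-07 (arXiv, Semantic Scholar, zbMATH; the local index and OpenAlex were unavailable in that session): clause (b) stands verbatim on p. 1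 of [cite: CheskidovPeng2025, §1], whose Rem. 1.5 (p. 3) records the one printed exclusion of a convex-integration flow from vanishing-viscosity limits — two-dimensional: the non-conservative integrable-vorticity flows of [cite: BrueColomboKumar2024, Thm. 1.2], by the 2D energy-conservation theorem for physically realisable flows with `L^p` vorticity (Cheskidov–Lopes Filho–Nussenzveig Lopes–Shvydkoy, CMP 348 (2016)) — a vorticity mechanism with no `T³` analogue, so on `T³` the exclusions remain the energy ceiling (e), the budget (g) and the regular-limit and shear-flow barriers (`BrenierDeLellisSzekelyhidi2011_cor1`, `BrueDeLellis2023_noAnomaly_beforeEulerSingularity`, `BardosTitiWiedemann2012_thm5`); the force-quality remark of (c) is printed in [cite: CheskidovLuo2021, §1] ("forcing given by convex integration solutions has small low frequencies. So the force can be made arbitrarily small in `L^∞_t W^{-1,1}`"; forced zero-anomalous-work constructions by convex integration "with current techniques … impossible in 3D"), and along `ν → 0` families the works converge whenever the forces converge in `L¹_t L²_x` [cite: CheskidovPeng2025, §1 (1.7)]; the Navier–Stokes side of (a)/(f) is unchanged (2026 additions: critical-Besov mild non-uniqueness from zero data [cite: Fujii2026, Thm. 1.2]; smooth non-uniqueness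 for hyperdissipation `(-Δ)^β`, `β > 1`, from subcritical negative-Besov data, arXiv:2605.29934; structural stability of the `2½`-dimensional `ν`-dependent-force construction, arXiv:2605.18126) — none reaches the Leray–Hopf class for `γ = 1` by convex integration. (re-audit 2026-08-17, generation 3, of the proof file) (i) the one quantitative threat cited by route EulerLimit against its realisation crux — the divergent work `≈ ν^{(3β-1)/(1+β)}` of [cite: BuckmasterVicol2020, Rem. 6.4] (p. 27 of arXiv:1901.09023: it "does not remain bounded as `ν → 0` since `β < 1/3` … it would be interesting to see whether a convex-integration scheme could be designed to reach the endpoint exponent `β = 1/3`") — is now a theorem about EVERY Leray–Hopf solution and every `C⁰_t L²` realisation, the third narrowed companion `ConvexIntegrationNonLerayResolutionNarrow` (sibling file `ConvexIntegrationNonLerayResolution`; theorems `IsLerayHopfOn.highModes_budget`, `lerayHopfLimit_highModes_le`, `lerayHopfLimit_rate_floor`): `4π²N² ‖(1-P_N)u‖²_{L²((0,T)×T³)} ≤ 8π²N² T sup_t ‖v-u‖₂² + 2(E(u₀) - E(v(T)) + ∫₀ᵀ(f,v))/ν` for every Leray–Hopf `v` (viscosity `ν > 0`, any force), every comparison field `u`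 and every frequency `N` (`P_N = Torus.fourierTruncate N`; spectral gap of the Galerkin complement [cite: RobinsonRodrigoSadowski2016, Lemma 4.1] plus the energy inequality [cite: Leray1934, §III (5.2)]) — `L²`-fidelity to `u` down to a frequency `N` costs enstrophy `≳ N²‖(1-P_N)u‖²`, and at the calibration of Rem. 6.4 (`N = ν^{-1/(1+β)}`, tail `≈ N^{-2β}`) the excess is exactly `ν^{(3β-1)/(1+β)}`; consequences: with ONE steady force `f ∈ L²` and bounded energies (the summit; the crux) the works are bounded (`≤ T‖f‖₂ sup‖v_n‖₂`), so the divergence of Rem. 6.4 cannot occur there — it is not an obstruction to realisation but a RESOLUTION constraint: a Leray–Hopf realisation is `L²`-faithful to `u` at best down to `N_n ≈ ((ΔE+W)/ν_n)^{1/(2-2θ)}` (`θ` the saturation exponent of `u`'s `L²_{t,x}` spectral tail; the Kolmogorov wavenumber `ν^{-3/4}` at `θ = 1/3` [cite: Frisch1995, (7.11) and (7.18)]), coarser than the viscous cutoff `ν_n^{-1/(1+θ)}` of a `C^θ` field [cite: Frisch1995, §8.5.5 (8.53)] exactly when `θ < 1/3`, converges no faster than `ν_n^{θ/(2(1-θ))}`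 in `C⁰_t L²` (`ν_n^{1/4}` at `θ = 1/3`), and its approximants carry strictly less `L²_{t,x}`-mass than `u` beyond `N_n` — they cannot have the shape "`u` mollified at the viscous scale plus a small corrector" shared by every approximant in print (Rem. 6.4; the start (2.12)–(2.15) of Thm. 1.3's scheme, `BuckmasterVicol2019_mollifiedEulerStart`; calibration (c) above, whose second choice `ν_q = ε₀/‖∇v_q‖²` is precisely the borderline `N ≈ (ΔE/ν)^{1/(2-2θ)}`), whereas "`u` truncated at the Kolmogorov-type scale plus a corrector" is not excluded by energy; (j) literature re-searched 2026-08-17, generation 3 (local index restored, arXiv reachable; OpenAlex and Semantic Scholar rate-limited): nothing new on the Navier–Stokes side at `γ = 1` — Leray–Hopf non-uniqueness for forced STOCHASTIC HYPERdissipative equations by the unstable-profile mechanism of [cite: AlbrittonBrueColombo2022AnnMath, Thm. 1.2] (arXiv:2503.18041), absence-of-anomaly theorems (Navier boundary conditions, arXiv:2509.12432; vortex sheets, arXiv:2504.18523; local energy balance in 2D, arXiv:2606.04218), stability of the `2½`-dimensional `ν`-dependent-force anomaly (arXiv:2605.18126); convex-integration velocities with anomalous SCALAR dissipation (Burczak–Székelyhidi–Wu,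 arXiv:2310.02934) concern passive scalars advected by typical flexible flows (barrier `ObukhovCorrsinThreshold`), not the realisation of the velocity. (re-audit 2026-08-17, generation 4, of the proof file) (k) the clause of `blocks:` "the printed reach of the technique on the Navier–Stokes side is the class of weak (Oseen) solutions of BV Def. 1.1" is exact for the Leray–Hopf question but understates the regularity the technique has reached at `γ = 1` for NON-UNIQUENESS, none of it inside `L^∞_t L² ∩ L²_t H¹` with the energy inequalities: weak solutions in `C⁰_t(H^β ∩ W^{1,1+β})`, smooth off a closed set of times of box dimension `< 1-β` [cite: BuckmasterColomboVicol2021, Thm. 1.1]; in `L^p_t L^∞_x ∩ L^1_t W^{1,q}_x` for every `p < 2`, `q < ∞`, `d ≥ 2`, smooth on intervals of full measure with the energy equality on each, `ε`-close to ANY prescribed smooth divergence-free zero-mean field [cite: CheskidovLuo2022, Thm. 1.7], sharp against the uniqueness class `L²_t L^∞_x` [cite: CheskidovLuo2022, Thm. 1.6]; in `C_t L^q`, `2 < q ≪ 3` [cite: MiaoZhao2025, Thm. 1.2] (the first half of the authors' own forecast "nonuniqueness of weak solutions in `C⁰_t L^p_x`, for any `2 ≤ p < 3`, and the nonuniqueness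 of Leray-Hopf weak solutions" [cite: BuckmasterVicol2019Annals, §1.2]); with continuous and even decreasing energy from every `H^{1/2}` datum, by a scheme that exploits `νΔ` instead of absorbing it ("standard convex integration schemes treat `ν∆u` as an error") [cite: CheskidovZengZhang2025, Thm. 1.2] — "While Leray-Hopf solutions are out of reach with this technique … constructed dissipative solutions can not satisfy the energy inequality, as the weak-strong uniqueness holds in the Leray-Hopf class" [cite: CheskidovZengZhang2025, p. 2]; and stationary singular (not `L²_loc`) solutions defeating unconditional uniqueness of mild solutions in every `B^{-θ}_{q,r}(T^d)`, `θ > 0` [cite: CheskidovHou2026, Thm. 1.1]; non-uniqueness in `C⁰_t L^q ∩ L²_t H¹`, `q ∈ [2,3)`, even WITHOUT energy inequality, is posed as open [cite: BuckmasterColomboVicol2021, §1.1], and [cite: CheskidovLuo2022, Thm. 1.6] "raises the question of whether such constructions can be extended to the Leray-Hopf solutions" (op. cit. §1.2); the obstruction is not one of scaling — the Leray–Hopf energy space is supercritical, `2/∞ + 3/2 = 3/2 > 1` [cite: BuckmasterColomboVicol2021, §1.1], the regime in which the technique operates — but the SQUARE time-integrability of the enstrophy (printed schemes stop at `C_t W^{1,1+β}`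 / `L¹_t W^{1,q}`) jointly with the energy inequality from a.e. time; a printed Leray–Hopf non-uniqueness mechanism that isolates convex-integration-type interactions exists in the dyadic Obukhov model [cite: Palasek2024LerayHopfDyadic, Thm. 1.2] ("the predominant nonlinear interactions are identical to those arising in convex integration, suggesting the possibility of a similar construction in the full PDE setting", op. cit. abstract), transferred to the PDE so far only outside finite energy [cite: CoiculescuPalasek2025, Thm. 1.2]; for the SUMMIT even a Leray–Hopf-class scheme would not suffice by itself: `Literature.Analysis.FluidPDE.meanDissipation` counts the VISCOUS dissipation `ν⟨‖∇u‖₂²⟩`, which the energy inequality from `0` [cite: Leray1934, §III (5.2)] bounds only from ABOVE by the mean input `⟨(f,u)⟩` when energies are bounded (equality for classical or energy-equality solutions), so a wild Leray–Hopf witness may lose its input to the defect instead of to viscosity (the finite-`ν` form of barrier `Cheskidov2023_thm21_noDissipationAnomaly`) — a convex-integration witness of `ZerothLaw` must DESIGN mean enstrophy `≈ ε/ν_j`, which is exactly the enstrophy `δ_K λ_K² = ε^{2/3} λ_K^{4/3} = ε/ν` of a K41-calibrated cascade (`δ_q ≈ (ε/λ_q)^{2/3}`, the endpoint `β = 1/3`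 no scheme reaches) terminated at the Kolmogorov frequency `λ_K = (ε/ν³)^{1/4}` [cite: Frisch1995, (7.11) and (7.18)], where the viscous stress `ν λ_K δ_K^{1/2} = (εν)^{1/2} = δ_K` equals the last resolved shell (local Reynolds number one; cf. the resolution budget (i)); (l) realisation MODES: the `C⁰_t L²` mode of Thm. 1.3 (approximants bounded in `C⁰_t H^β`) is meaningful — the nonlinearity converges in `C⁰_t L¹` and the limit is a weak Euler solution — whereas below `L²` strength in time realisation is VACUOUS: from the density theorem [cite: CheskidovLuo2022, Thm. 1.7], in whose construction "the Laplacian plays no role" (op. cit. §2.1; [cite: CheskidovLuo2022, Thm. 1.9] is the case `ν = 0`), and the passage `w(t,x) = ν u(νt,x)` from viscosity `1` to viscosity `ν` on `T^d = (ℝ/ℤ)^d`, EVERY continuous divergence-free zero-mean field on `[0,T] × T³` — solving no equation — is the `L^p(0,T; L^∞)` limit (`p < 2`) of a.e.-smooth weak Navier–Stokes solutions with ANY prescribed viscosities `ν_n → 0` (audit remark, elementary from the cited theorem, not printed), so realisation statements carry information only from `L²_{t,x}` strength upwards (the strong `L³_{t,x}` clause of crux VanishingViscosityRealizationV2 is on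 the informative side); the Euler-side status is unchanged — convex-integration flows "are still not known to arise as vanishing-viscosity limits of physical Navier–Stokes solutions. In addition, solution[s] to the Navier-Stokes equations obtained via convex integration do not produce the Kolmogorov dissipation range" [cite: CheskidovPeng2025, §1] — as is the Leray–Hopf reach in neighbouring dissipations (deterministic fractional Navier–Stokes: `0 < α < 1/3` [cite: LangeRehmeierSchenke2024, §1]); literature sweep of generation 4 (2026-08-17; arXiv and the local index reachable, OpenAlex budget exhausted, Semantic Scholar rate-limited, galaxy corpora saturated): arXiv 2026-01–2026-08 under "anomalous dissipation", "convex integration", "Leray–Hopf", "Onsager", "vanishing viscosity" returns boundary-driven and Stokes-flow anomalies, 2D and vortex-sheet no-anomaly theorems, compressible and geophysical convex integration, passive-scalar regularity thresholds (arXiv:2603.11466, barrier `ObukhovCorrsinThreshold`), MHD instantaneous blow-up (arXiv:2604.08684) and [cite: CheskidovHou2026, Thm. 1.1] — nothing reaching the Leray–Hopf class at `γ = 1` by convex integration and no same-force Leray–Hopf or classical realisation of a convex-integration flow; no fourth narrowed companion is filed: the energy (e), budget (g) and resolution (i) constraints exhaust what the Leray–Hopf energy inequalities give in the `C⁰_t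 L²` mode, and their transplant to the `τ`-periodic same-force setting of route EulerLimit is the period balance `ν_j∫₀^τ‖∇u_j‖² = ∫₀^τ(f,u_j)` already carried by that route's support item PeriodAverageBalanceV2. (re-audit 2026-08-17, generation 5, of the proof file) (m) tree state re-verified: `BuckmasterVicol2019_thm13_holds` closes this vendored fact with axioms `propext`, `Classical.choice`, `Quot.sound`, so only the SCOPE of this block, never the fact, can be contested, and the notions it rests on (`Torus.IsWeakNSSolutionOn`: an `L²_{t,x}`-guarded distributional identity, so no Bochner junk; `Torus.IsNSReynoldsOn`) were re-read for junk models — none; (n) technique_class coverage: the tokens are covered for convex-integration constructions including their h-principle / Baire form on the Navier–Stokes side — residual sets of wild `C_t L²` weak solutions with prescribed energy [cite: SattigSzekelyhidi2023, Thm. 5], and in the space of `L^∞_t L²` distributional solutions the Leray ones are NOWHERE DENSE while the ones smooth on some time interval are meagre [cite: ColomboDeRosaSorella2022, Thm. 1.1] — all outside `L²_t H¹`; the token `wild-solutions` means convex-integration wild solutions: instability-generated Leray–Hopf non-uniqueness [cite: AlbrittonBrueColombo2022AnnMath, Thm. 1.2] [cite: HouWangYang2025, §1] lies inside the Leray–Hopf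 class and outside this block's `because:` argument (caveat (a)); cross-model, intermittent convex integration DOES produce non-unique weak solutions in `L^∞_t L² ∩ L²_t H¹` at full Laplacian dissipation once the nonlinearity carries one more derivative — 3D Hall-MHD, the scheme being run on the current `J = ∇ × B` so that `B` gains a derivative [cite: Dai2021HallMHD, Thms. 1.1–1.2] (arXiv:1812.11311, pp. 3–4; the same introduction forecasts for Navier–Stokes `C⁰_t H^β`, `β < 1/2`, with `Ḣ^{1/2}` "a major barrier") — consistent with (k): at `γ = 1` the obstruction is the derivative count of the Navier–Stokes nonlinearity against the `L²_t H¹` energy class, not the dissipation order alone; (o) hypothesis class: weak Euler solutions in `L^∞_t C^θ_x`, `θ ∈ (0,1)`, are `C^θ_{t,x}` [cite: ColomboDeRosa2020, Thm. 1.1] (Isett 2013 earlier), so the `C⁰_t C^α_x` flows of crux VanishingViscosityRealizationV2 lie in the hypothesis class of Thm. 1.3, up to its steady smooth force and zero mean (lower order in the start (2.12)–(2.15) and in Prop. 2.1; not printed); (p) caveat (l) is now a THEOREM of the tree, `weakNS_realisation_LpLinfty` / `weakNS_realisation_LpLinfty_seq` of the sibling file `ConvexIntegrationNonLerayWeakModes`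 (from the tree theorems `CheskidovLuo2022MainTheorem_holds` [cite: CheskidovLuo2022, Thm. 1.7] and `isWeakNSSolutionOn_time_rescale`): for every `T > 0`, `1 ≤ p < 2`, `ε > 0`, every viscosity `ν ∈ (0,1]` and every jointly smooth divergence-free zero-mean field `U` on `[0,T] × T³` — solving no equation — there is a weak Navier–Stokes solution `w` of viscosity `ν` on `T³ × (0,T)`, zero-mean for a.e. `t`, in `L^p_t L^∞_x`, with `‖w - U‖_{L^p(0,T;L^∞)} ≤ ε`; realisation below `L²_t` strength certifies nothing (not even that `U` solves Euler), and realisation items of routes must be at least `L²_{t,x}`-strong to carry information; (q) the K41 sentence closing (k) and the clause "exactly when `θ < 1/3`" of (i) concern SPACE-FILLING spectral tails: for an `L²_{t,x}`-tail exponent `θ ≥ 1/3` — the regime of intermittent dissipative flows, Hölder-continuous ones included (`β`-model families [cite: DeRosaIsett2024, Thm. 1.1]; `L³`-based flows [cite: GiriKwonNovack2026, Thm. 1.1]; `H^{1/2-}` flows [cite: NovackVicol2023, Thm. 1.1]) — the resolution budget (i) still imposes the rate floor `S_n ≳ ν_n^{θ/(2(1-θ))}` but NO shape constraint (the affordable resolution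 `ν_n^{-1/(2-2θ)}` lies at or beyond the local-Reynolds-number-one cutoff), and the terminal-shell bookkeeping of (k) becomes the `β`-model one, `μ_Q = λ_K φ_Q^{-1/4}`, `δ_Q = δ_K φ_Q^{1/2}` for an active volume fraction `φ_Q` [cite: Frisch1995, §8.5]; for such flows the catalogued constraints on a same-force Leray–Hopf realisation reduce to the energy AMOUNTS (e), (g) (audit computation, not printed; recorded as an idea-card seed in the audit notes); (r) literature re-searched 2026-08-17, generation 5 (arXiv and zbMATH reachable; OpenAlex budget exhausted, Semantic Scholar rate-limited): the queries "Leray–Hopf non-uniqueness", "hypodissipative / fractional … Leray–Hopf", "vanishing viscosity … convex integration", "anomalous dissipation Navier–Stokes" (2025–), "intermittent convex integration Navier–Stokes", "energy inequality convex integration" return only items already in (a)–(l) plus boundary-driven Stokes-flow anomalies (arXiv:2501.00705) — nothing reaching the Leray–Hopf class at `γ = 1` by convex integration, and no same-force Leray–Hopf or classical realisation of a convex-integration flow. (re-audit 2026-08-17, generation 6, of the proof file) (s) SCOPE ON THE SUMMIT SIDE — steady and smooth-designed witnesses lie outside the printed argument of this block: `ZerothLaw` is existential over global Leray–Hopf families,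 and every classical (smooth) solution of the steadily forced equations, in particular every STEADY state, is a global Leray–Hopf solution from its own datum (`Torus.isGlobalLerayHopf_of_isClassicalNSSolutionOn_holds`; for steady states `meanEnergy = ‖u‖₂²` and `meanDissipation = ν‖∇u‖₂²`, route theorem `steadyToSummit_proof` with `coherent_assembly_fact`); steady weak solutions `u ∈ V` of `ν`-Navier–Stokes with force `f ∈ L²` exist for every `ν > 0` [cite: Temam1979, Ch. II §1 Thm. 1.2] (`Torus.Temam1979_exists_steadyWeakSolution_holds`), satisfy the energy EQUATION `ν‖∇u‖₂² = (f,u)` [cite: Temam1979, Ch. II §1 (1.21)–(1.22)] (`Temam1979_steadyWeakSolution_energy_eq_holds`) and are smooth on `T³` for smooth `f` [cite: Temam1979, Ch. II §1 Prop. 1.1] (`Torus.Temam1979_steadyWeakSolution_smooth_holds`). Hence for steady witnesses every clause of `because:` is void — no Cauchy datum and no energy inequality to violate (equality is automatic in `V`), no `L²_t Ḣ¹_x` integrability at stake (`V = H¹`), no weak–strong uniqueness to contradict (a smooth steady state is the strong solution from its own datum; steady states are unique only for `ν` large against `‖f‖_{V'}`, the uniqueness theorem of [cite: Temam1979, Ch.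 II §1]), and no divergent work ([cite: BuckmasterVicol2020, Rem. 6.4] is a Cauchy calibration; for a steady state the work IS the dissipation) — and the companions degenerate: the energy ceiling (e) is empty, the budget (g) is the identity `ν_j‖∇u_j‖₂² = (f_j,u_j) → (f,v)` along any `L²`-bounded steady family with `f_j → f` in `L²` and `u_j ⇀ v` weakly in `L²` (route theorem `injectionWeaklyContinuous_proof`: the transmitted dissipation is exactly the limit's power intake, positive iff the weak limit is not orthogonal to `f`), and the resolution budget (i) is the Chebyshev tail bound `4π²N²‖(1-P_N)u_j‖₂² ≤ (f,u_j)/ν_j`, with no shape constraint. The steady branch of the technique class exists and is NOT addressed by the printed argument either: the stationary h-principle gives, `H^{-1}`-near every smooth steady flow and with prescribed `|v|² = e`, infinitely many bounded steady Euler flows on `T^d`, `d ≥ 2` [cite: ChoffrutSzekelyhidi2014, Thm. 1] (arXiv:1401.4301, p. 3; with a linear source `Bv`, [cite: HuangSteadyEulerSources2024, Thm. 1.1(a)]), and Hölder steady Euler flows on `T³` with the topology of any prescribed smooth solenoidal field [cite: EncisoPenafielTomasPeraltaSalas2025, Thm. 1.1] — by other means than the Onsager schemes, which "do not apply to the stationary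 case. Indeed, a very delicate part in these proofs is to use the transport operator `∂_t + v·∇` to absorb the main (linear) part of the error in the iteration" [cite: ChoffrutSzekelyhidi2014, p. 3]; the FORCED stationary h-principle — a bounded, weakly divergence-free steady Euler flow on `T³` driven by a smooth steady (Kolmogorov-type) force and absorbing positive power `(f,v) > 0`, necessarily not `C¹` — is not in print with an external force but is a theorem of the tree (`standingCascadeExists_proof`, route SteadyWeakLimit: the iteration of [cite: ChoffrutSzekelyhidi2014, Thm. 1], formalised as `Literature.Analysis.FluidPDE.StationaryEuler.*`, run in the affine space of strict subsolutions of `div v = 0`, `div u + ∇q = f`); so the Euler-side object of a steady witness — a standing cascade, or more generally a strict stationary subsolution `div(v⊗v+R) + ∇p = f`, `R ⪰ 0`, with production `(f,v) = -∫R:∇v > 0` (route theorem `productionIdentity_proof`) — exists, whereas on the Navier–Stokes side steady convex integration at `γ = 1` reaches `L²(T^d)` only for `d ≥ 4` [cite: Luo2019, Thms. 1.4 and 1.7] ("the existence of nontrivial stationary weak solutions of the 3D NSE still remains open", op. cit. p. 5 of arXiv:1807.09318; the building blocks have intermittency dimension `D = 1` and "if a weak solution … is of intermittency `D ≥ d-2`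 then it is regular", pp. 6, 9) and, in every `T^d`, `d ≥ 2`, singular stationary states that are not `L²` (`u⊗u` a paraproduct in `Ḣ^{-s}`) [cite: CheskidovHou2026, §1.3 and Thm. 1.1] — no loss for the summit, since a steady witness needs exact smooth states at each `ν_j`, which every `V`-solution is. For steady witnesses this block therefore records neither a printed reach nor a printed obstruction: the steady same-force realisation — an `L²`-bounded family of steady states at fixed smooth `f` whose intake `(f,u_j) = ν_j‖∇u_j‖₂²` does not vanish, equivalently whose weak limits are not orthogonal to `f` (route SteadyWeakLimit cruxes `SteadyWeakRealisation`, `SteadyRealisationSubviscousForce`; CoherentStates `SteadyZerothLaw`; negative twin `SteadyNeg`) — is open as printed, "the existence of bounded sequences of stationary solutions of the periodic, forced Navier-Stokes equations, and even of solutions with bounded average dissipation of energy are open problems" [cite: ConstantinTarfuleaVicol2013, p. 3] (arXiv:1305.7089), rigid in the two-dimensional Kolmogorov analogue (`‖Au‖₂² = λ‖u‖²_{H¹} ≤ λ²E` for `L²`-bounded steady families forced by a Stokes eigenfield, hence strong `H¹` convergence and `ν‖u^{(ν)}‖²_{H¹} → 0` [cite: ConstantinTarfuleaVicol2013, p. 6]),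 with [cite: BCCDS2024, Open Question 1] as its Cauchy form; the catalogued obstructions that do bear on steady witnesses are the laminar-attractor / gravest-mode and shear-selection entries (`GravestModeLaminarAttractor*`, `ShearFlowViscositySelection*`) and, in two dimensions, `TwoDimensionalEnergyDissipation`, not this one, and route reviews should not score this block against steady or smooth time-periodic constructions beyond the statement that their same-force realisation is open. The same holds for any witness family of EXACT smooth solutions whose multiscale structure is designed by a TRUNCATED convex-integration iteration closed by one viscous (elliptic or parabolic) step (the calibrations of (c), (i), (k); crux `SubviscousDefectAbsorption`): the Leray–Hopf class is automatic for them, and the live obstruction is the closure estimate — control of the corrector against the pairing with `f` and against the designed enstrophy — on which nothing is printed at `γ = 1`; (t) tree and literature re-verified 2026-08-17, generation 6: `#print axioms BuckmasterVicol2019_thm13_holds` = {`propext`, `Classical.choice`, `Quot.sound`}; caveat (a) re-read at page level — "not in the Leray–Hopf class due to the fact that the initial velocity is not in `L²(T³)` … this simplification requires the data to have infinite energy" [cite: CoiculescuPalasek2025, Rem. 1.5], "convex integration at or above critical regularity appears out of reach" [cite: CoiculescuPalasek2025, §1.2.1]; literature (arXiv and zbMATH reachable; the local index, OpenAlex and Semantic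 Scholar unavailable in this session; galaxy corpora saturated) under "steady / stationary convex integration", "Leray–Hopf non-uniqueness" (2025–), "convex integration Navier–Stokes" (2026), "anomalous dissipation Navier–Stokes" (2026), "steady Euler Hölder": three-dimensional STATIONARY convex integration has reached electron-MHD, whose nonlinearity carries one more derivative (Q. Peng, Nonlinear Anal. (2026), doi:10.1016/j.na.2025.113935; cf. (n)); flexibility and rigidity of steady flows near Couette in a channel (arXiv:2605.19971), forward self-similar profiles for 2D hypodissipative Navier–Stokes (arXiv:2603.12497), smooth non-uniqueness from critical data on `T²` and for 5D MHD (arXiv:2602.19074, arXiv:2603.21800) — nothing reaching the Leray–Hopf class at `γ = 1` by convex integration, no same-force Leray–Hopf, classical or steady realisation of a convex-integration flow, and no `L²`-bounded steady family with non-vanishing intake at fixed `f` in `d = 3`. (re-audit 2026-08-17, generation 7, of the proof file) (u) STATISTICALLY STATIONARY MODE — the mode in which the summit's functionals (`limsup` Cesàro means) live: by stochastic convex integration there are infinitely many stationary and ergodic stationary solutions (shift-invariant laws on trajectories) of the deterministic unforced and of the stochastically forced 3D Navier–Stokes and Euler equations on `T³`, with paths in `C(ℝ;H^ϑ) ∩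 C^ϑ(ℝ;L²)` and prescribed mean energy, and the law of EVERY stationary Euler solution with a finite moment in that class is the limit in law in `C(ℝ;L²_σ)` of stationary Navier–Stokes solutions with `ν_n → 0` [cite: HofmanovaZhuZhu2022Ergodicity, §1 and §5 Thm. 5.1] (arXiv:2208.08290, pp. 5–6, 20–23; the deterministic extension, §6, is for zero external force) — the long-time-statistics analogue of Thm. 1.3, with the same reach: "If `ν > 0`, they do not satisfy the corresponding energy inequality … the solutions to the Navier–Stokes equations we obtain are generally not the so-called Leray solutions, an issue inherent to all convex integration schemes for the Navier–Stokes equations" [cite: HofmanovaZhuZhu2022Ergodicity, p. 5]; unforced, the Leray exclusion in this mode is elementary (a stationary-in-law Leray–Hopf statistic of the unforced equations with finite mean energy has constant mean energy, hence zero mean enstrophy by the energy inequality from a.e. time, and is spatially constant — zero for mean-free fields), so the informative stationary question is the steadily forced one, open exactly as in (s); (v) LATE-TIME RIGIDITY OF LERAY–HOPF WITNESSES: `meanEnergy` and `meanDissipation` do not see any finite initial layer (`Torus.IsGlobalLerayHopf.meanEnergy_translate`, `Torus.IsGlobalLerayHopf.meanDissipation_translate`), and a Leray–Hopf solution lying in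 a Serrin class `L^s_loc((t₀,∞); L^q)`, `3/q + 2/s ≤ 1`, `q > 3`, is on `[t₁,∞)`, for a.e. `t₁ > t₀`, the unique Leray–Hopf continuation of its own slice `u(t₁)` (Serrin–Masuda weak–strong uniqueness with force [cite: Sohr2001, Ch. V Thm. 1.5.1]; the tree's unforced `ℝ³` form is `Literature.Analysis.FluidPDE.weak_strong_uniqueness_holds`); hence Navier–Stokes-side flexibility of ANY provenance — convex integration in the Leray–Hopf class, were it reached at `γ = 1`, or the instability bifurcations of [cite: AlbrittonBrueColombo2022AnnMath, Thm. 1.2] [cite: HouWangYang2025, §1], which branch at the initial singular time only — can shape the summit's functionals only through witnesses `u_j` that leave every Serrin class on `(t₀,∞)` for every `t₀`, i.e. that are singular at arbitrarily late times at FIXED `ν_j > 0` under a smooth steady force; eventual regularity of forced Leray–Hopf solutions at large Grashof number being open, this is not excluded, but it ties a flexible Leray–Hopf witness to recurrent singularity formation at positive viscosity, while an eventually-Serrin witness is the strong evolution of one late slice, designed at most through that datum (audit remark, not printed); (w) tree and literature re-verified 2026-08-17, generation 7: `#print axioms BuckmasterVicol2019_thm13_holds` = {`propext`, `Classical.choice`,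 `Quot.sound`}; [cite: Derosa2018, Thm. 1.3] re-read at page level (existential in the Euler flow; `evasions_known` reworded); the deterministic fractional Leray–Hopf threshold stands at `α < 1/3` (Colombo–De Lellis–De Rosa, De Rosa, Gorini, as listed on p. 2 of [cite: LangeRehmeierSchenke2024, §1]), and the other weaker-dissipation instance of the Leray–Hopf reach is the power-law (shear-thinning) fluid below the compactness exponent, `q < 2d/(d+2) = 6/5` on `T³` [cite: BurczakModenaSzekelyhidi2021, §1.3.1], whose scheme run on Navier–Stokes itself gives weak solutions with `∇v ∈ L^{6/5-}` only (op. cit. §1.5, p. 5 of arXiv:2007.08011) — the `L²_t H¹` gap of (k) in another metric; literature (arXiv and zbMATH reachable; the local index, OpenAlex and Semantic Scholar unavailable in this session; galaxy corpora saturated) under "Leray–Hopf non-uniqueness / nonuniqueness" (2024–2026), "hypodissipative Navier–Stokes", "vanishing viscosity + convex integration", "anomalous dissipation + Navier–Stokes" (2025–), "convex integration + Navier–Stokes / Euler" (2025–2026), "Onsager + Navier–Stokes" (2026), "stationary Navier–Stokes weak solutions" (2026), "zeroth law": forced 2D Navier–Stokes and dissipative SQG non-uniqueness below the Ladyzhenskaya–Prodi–Serrin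 class (arXiv:2601.00331), positive-regularity norm inflation for 3D hypodissipative Navier–Stokes (arXiv:2607.24635), homothetic self-similar Navier–Stokes solutions (arXiv:2607.12159), blow-up versus uniqueness of forced Leray–Hopf solutions (arXiv:2606.15189), admissibility of compressible convex-integration fans (arXiv:2608.02482) — nothing reaching the Leray–Hopf class at `γ = 1` by convex integration, and no same-force Leray–Hopf, classical, steady or stationary-statistical realisation of a convex-integration flow. (re-audit 2026-08-17, generation 9, of the proof file) (x) FORCE TOPOLOGY — the clause of `blocks:` "the vanishing-viscosity realisation of convex-integration Euler solutions by Leray–Hopf or classical Navier–Stokes solutions" is open only as a statement about the FORCE: with `ν`-dependent forces the Leray–Hopf — indeed classical — realisation of EVERY zero-mean Hölder weak Euler flow (dissipative, conservative or energy-gaining, unique or not) is a theorem of the tree, `holderEuler_lerayHopf_realisation_smallForce` with `holderEuler_lerayHopf_realisation_eventually(_seq)` and the Thm.-1.3-shaped `BuckmasterVicol2019_thm13_lerayHopf_smallForce` of the sibling file `ConvexIntegrationNonLerayForceTopology` (generation 9): for `u` as in this fact, `0 < β' < (β̄ ∧ 1)/2`, every `η > 0` and EVERY sufficiently small `ν >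 0` (not only along a sequence), some classical solution `(v, p)` of Navier–Stokes with viscosity `ν` on `[0,T] × T³` (the space–time mollification of `u` at length scale `ν`), driven by a smooth force `f^ν = div R` with `sup |R| ≤ η` — so `f^ν → 0` in `C⁰_t W^{-1,∞}`, a fortiori in `L²_t H^{-1}` —, is a Leray–Hopf weak solution on `[0,T)` for that force (energy equality, `L²_t H¹_x`; `Torus.IsClassicalNSSolutionOn.isLerayHopfOn_of_convex` [cite: RobinsonRodrigoSadowski2016, Thm. 6.5]), zero-mean, `η`-close to `u` in `C⁰_t H^{β'}_x` and `C⁰_t L²_x` and bounded in `C⁰_t H^{β'}_x` uniformly in `η, ν` — the scheme's own start (2.12)–(2.15) [cite: BuckmasterVicol2019Annals, §2.5 (2.12)–(2.15)] (tree theorem `BuckmasterVicol2019_mollifiedEulerStart_holds`) read through "the Navier–Stokes equations with a `C^∞` smooth forcing term `f^ν = div F^ν`" [cite: BuckmasterVicol2020, Rem. 6.4] (`Torus.IsForcedNSReynoldsOn.isClassicalNSSolutionOn_add`), no iteration being needed in the Leray–Hopf class once the force is conceded; the energy companions (e), (g), (i) are not contradicted but PAID by the work `∫₀ᵀ(f^ν,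 v^ν)`, which does not vanish with `‖F^ν‖_{C⁰}` (it diverges at the `C^β`-saturated calibration [cite: BuckmasterVicol2020, Rem. 6.4]; the "anomalous work" of [cite: CheskidovLuo2021, §1], where the smallness of convex-integration forces in `L^∞_t W^{-1,1}` is recorded), whereas forces converging in `L¹_t L²_x` carry the works to their limit along `C⁰_t L²`-convergent bounded-energy families [cite: CheskidovPeng2025, §1 (1.7)] — so (e), (g), (i) hold verbatim with the limiting work — and, before an Euler singularity, force convergence to the classical Euler flow (`BrueDeLellis2023_lemma7_convergence` of barrier `ClassicalEulerLimit` [cite: BrueDeLellis2023, §2]); hence realisation items are informative exactly from `L¹_t L²_x`-control of `f_n - f` upwards (the same steady `f` of crux VanishingViscosityRealizationV2 and of the summit included) and vacuous at `W^{-1,∞}` strength — the force-side twin of (p) — and the weak–strong-uniqueness clause of `because:` constrains Leray–Hopf flexibility only on time intervals carrying a strong solution from the same datum and force (smooth or `H^{1/2}` data: [cite: CheskidovZengZhang2025, p. 2]; "an instantaneous blow-up can occur in the Leray–Hopf class only after the appearance of a finite-time blow-up" [cite: CheskidovDaiPalasek2025, §1.2]), not the realisation of a `C^β` flow from its own rough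 slices, for which no strong solution is known and Leray–Hopf non-uniqueness from rough data is a theorem by other mechanisms (caveat (a)); (y) caveat (k) re-read at page level against the sharpest printed intermittent scheme at full Laplacian: strong non-uniqueness in `L^γ_t W^{s,p}_x` is PROVED throughout the regime `𝒜₂ = {0 ≤ s < 2α/γ + (2α-2)/p + 1 - 2α}` [cite: LiQuZengZhang2022, Thm. 1.2] (p. 6 of arXiv:2205.10260; `α ∈ [1,2)`, sharp at the endpoint `(2α/γ + 1 - 2α, γ, ∞)` of the generalised Ladyzhenskaya–Prodi–Serrin line), which at `α = 1` reads `s < 2/γ - 1` — the temporally intermittent corner (`γ < 2` at `s = 0`; a full derivative `s → 1` forces `γ → 1`); the regime is sufficient, not exhaustive — the `C⁰_t H^β_x` solutions of the vendored theorem lie in `L²_t H^β_x`, `β > 0`, outside `𝒜₂` (generation 13 correction of the earlier wording "holds exactly … beyond the reach, uniformly in `p`") — while the opposite corner, near the endpoint `(3/p - 1, ∞, p)` (at `p = 2` the scale `L^∞_t H^{1/2-}`), "seems out of the reach of present method, due to the `L²_{t,x}`-criticality of space-time convex integration method … the temporal intermittency allows to raise the temporal integrability exponent `γ > 2`, yet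 at the cost of reducing the spatial integrability exponent `p < 2`" (op. cit. p. 7, crediting Cheskidov–Luo [cite: CheskidovLuo2022, Thm. 1.7]); so at the energy exponents `γ = p = 2` intermittency buys nothing, and the energy class `L²_t H¹_x` (`γ = 2`, `s = 1`) lies a full derivative beyond `𝒜₂`, outside every printed reach, and half a derivative beyond the cap of (aa) — the unreached quantity is the SQUARE space–time integrability of ONE derivative, as (k) and (n) state, not spatial integrability or scaling; literature re-searched 2026-08-17, generation 9 (arXiv reachable; the local index intermittent; OpenAlex/Semantic Scholar not queried; galaxy corpora cached, no new rows): "Leray–Hopf non-uniqueness … convex integration" (2023–), "sharp non-uniqueness Navier–Stokes supercritical" (2022–), "anomalous dissipation … viscosity-independent / fixed force / forced Navier–Stokes" (2024–), "vanishing viscosity Leray–Hopf wild Euler" return [cite: Palasek2024LerayHopfDyadic, Thm. 1.2], [cite: LangeRehmeierSchenke2024, §1], arXiv:2411.06133 and arXiv:2408.05450 (stochastic hyperviscous / MHD non-Leray–Hopf solutions by intermittent schemes), arXiv:2605.18126, arXiv:2409.03599 (two-dimensional autonomous spontaneous-stochasticity scalar anomaly), arXiv:2504.13298 (phenomenology of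 the zeroth law) — nothing reaching the Leray–Hopf class at `γ = 1` by convex integration and no same-force (or `L¹_t L²`-convergent-force) Leray–Hopf, classical or steady realisation of a convex-integration flow. (re-audit 2026-08-17, generation 10, of the proof file) (z) GENERICITY — the live class of (e) is meagre: in the complete metric space `X_θ` of De Rosa–Tione (the `C^θ_{x,t}`-closure of the `C^{θ'}`-weak Euler solutions on `T³ × [0,T]`, `θ' > θ`, with the `C^θ_{x,t}` distance), for every `θ ∈ (0,1/3)` the set `Y_θ` of solutions whose kinetic energy `e_v` lies in `C^{2θ/(1-θ)}([0,T])` but in no `W^{2θ/(1-θ)+ε,p}(I)`, `ε > 0`, `p ≥ 1`, `I ⊂ [0,T]` open, is RESIDUAL [cite: DeRosaTione2022, Thm. 1.2] (arXiv:1908.03529, p. 3; the Isett–Oh conjecture, in the space `X_θ`), whence "the typical solution in `X_θ` is not of bounded variation, thus not monotonic, in any open subset of `[0,T]`" (loc. cit.), and the smooth solutions are nowhere dense in the space `C_θ` of all `C^θ_{x,t}` weak solutions [cite: DeRosaTione2022, Thm. 1.3]; every element of `Y_θ` — after the Galilean normalisation `v(x + tm, t) - m` of its constant mean `m`, which shifts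 the energy by the constant `|m|²` — is a zero-mean Hölder weak Euler flow realised in `C⁰_t L²` by weak Navier–Stokes solutions by this fact, and by NO sequence of unforced Leray–Hopf solutions, whatever the viscosities and the data, on `[0,T]` or on any subinterval (its energy rises strictly between two times of every interval: `not_lerayHopfLimit_of_eLpNorm_lt_of_le` of the sibling file `ConvexIntegrationNonLerayEnergyCeiling`), nor — from `L²`-convergent data at any of the densely many initial times that are not right local maxima of `e_v` (a continuous function all of whose points are right local maxima is non-increasing) — by Leray–Hopf solutions with forces whose works vanish, `∫₀ᵗ(f_n, v_n) → 0` (`lerayHopfLimit_dissipation_le` of `ConvexIntegrationNonLerayDissipationBudget` with `W = 0`: a nonnegative dissipation would lie below a negative energy drop); so "most of the dissipative solutions produced by these methods cannot arise as vanishing viscosity limits of Leray solutions" [cite: BrueDeLellis2023, §2] (p. 5 of arXiv:2207.06301, re-read; restated 2025: "Whether any of the non-unique solutions exhibited in [Isett 2018; BDLSV 2019; Giri–Kwon–Novack] can be obtained in the vanishing viscosity limit is an open problem", p. 3 of arXiv:2507.19257 [cite: AlbrittonColomboMescolini2025, Thm. 1.1]) holds in the sense of category: the open realisation problem of `blocks:`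 is confined to a MEAGRE subset of the flexible class — flows with monotone energy on some interval; for the summit the purpose-built globally dissipative ones of (e) [cite: Isett2022, Thm. 1] [cite: DelellisKwon2022, Thm. 1.1] [cite: GiriKwonNovack2026, Thm. 1.1] — and no genericity or h-principle transfer ("the typical flexible flow is a viscosity limit", residual sets of realisable flows, Baire arguments in `X_θ`) can serve a route; on the force axis of (x) the dividing line for typical flows is the WORK functional, not a norm: realisable classically with `W^{-1,∞}`-small forces doing non-vanishing work (`holderEuler_lerayHopf_realisation_smallForce`), unrealisable in `C⁰_t L²` under any forcing whose works vanish — forces `L²_x`-orthogonal to the approximants at each time included, of whatever size (not printed; immediate from the two theorems); (aa) WHY `L²_t Ḣ¹` — technique-class coverage re-derived from the schemes' own bookkeeping (audit computation quantifying the printed "`L²_{t,x}`-criticality of space-time convex integration" [cite: LiQuZengZhang2022, p. 7]; a design constraint on the class, not a no-go theorem): in every scheme of the class the increment `w_{q+1}` cancels the stress through the low-frequency part of `w_{q+1} ⊗ w_{q+1} ≈ ρ Id - R̊_q` with `ρ ≳ |R̊_q|`, so its space–time `L²` mass is PINNED from below, `‖w_{q+1}‖²_{L²_{t,x}} ≳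 ‖R̊_q‖_{L¹_{t,x}}`, while that mass sits at frequencies `|k| ≈ λ_{q+1}` (for intermittent jets or pipes as well: their coarsest active frequency `λ_{q+1} r_⊥` is lower but carries a vanishing fraction of the mass, the blocks being concentrated at scale `λ_{q+1}^{-1}`); Plancherel at each time gives `‖w_{q+1}‖²_{L²_t Ḣ^s} ≈ λ_{q+1}^{2s} ‖w_{q+1}‖²_{L²_{t,x}} ≳ λ_{q+1}^{2s} ‖R̊_q‖_{L¹_{t,x}}` — spatial or temporal intermittency lowers the `L^γ_t W^{s,p}_x` size of the increments for `γ < 2` or `p < 2` (whence `C⁰_t W^{1,1+β}` [cite: BuckmasterColomboVicol2021, Thm. 1.1], `L¹_t W^{1,q}` [cite: CheskidovLuo2022, Thm. 1.7] and the region `s < 2/γ - 1` of (y) [cite: LiQuZengZhang2022, Thm. 1.2]) but has no effect at the energy exponents `γ = p = 2`; membership of the series in `L²_t Ḣ^s` thus needs `Σ_q λ_{q+1}^{2s} ‖R̊_q‖_{L¹_{t,x}} < ∞`, stresses decaying like `λ_{q+1}^{-2s-}`, against the amplitude-modulation part `ℛ[(∇a_k²)(W_k ⊗ W_k - ⨍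 W_k ⊗ W_k)]` of the oscillation error, of size `≈ ‖R̊_q‖_{L¹} λ_q/λ_{q+1}` at the least (the amplitudes are modulated at the frequency `≳ λ_q` of `R̊_q` — the estimates pay `ℓ_q^{-1} ≥ λ_q` — and the divisor is the smaller `λ_{q+1} r_⊥` for intermittent blocks): `δ_{q+2} ≳ δ_{q+1} λ_q/λ_{q+1}`, i.e. `β ≤ 1/(2b) < 1/2` for `δ_q = λ_q^{-2β}`, `λ_{q+1} = λ_q^b` — one-step cascades reach `L²_t Ḣ^s` and `C⁰_t H^s` at most for `s < 1/2`, in every dimension and for every intermittency (the cap is attained on the Euler side by the `C⁰_t H^{1/2-}` flows of [cite: NovackVicol2023, Thm. 1.1], and is the "`Ḣ^{1/2}` … major barrier" forecast for Navier–Stokes in [cite: Dai2021HallMHD, §1], caveat (n)), so the energy class `L²_t Ḣ¹` lies half a derivative BEYOND the cap, not at the margin of current estimates of the dissipative term; consistently, the technique reaches an energy class exactly where the pinned quantity sits one derivative lower — Hall-MHD run on the current, `B = curl⁻¹ J` gaining the derivative [cite: Dai2021HallMHD, Thms. 1.1–1.2] — or where the dissipation asks for less than the spatial regularity the Euler scheme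 supplies for free, `C⁰_t C^β ⊂ L²_t H^γ` for `γ < β < 1/3` (the hypodissipative Leray–Hopf reach `γ < 1/3` of `evasions_known` and (w) [cite: ColomboDelellisDerosa2018, Thm. 1.2] [cite: Derosa2018, Thm. 1.2]), and at `γ = 1` only where the Laplacian is principal: heat-dominated closures with finitely many flexible scales at each positive time, flexibility concentrated at one singular time [cite: CoiculescuPalasek2025, Thm. 1.2] [cite: CheskidovDaiPalasek2025, Thm. 1.1] ((a), (k), (v)); for the summit this re-derives (k), (n), (y) uniformly — at fixed `ν_j > 0` a Leray–Hopf witness cannot carry an infinite convex-integration series in the energy space, and a designed witness must close finitely many scales exactly ((s), last paragraph; crux `SubviscousDefectAbsorption`); (bb) tree and literature re-verified 2026-08-17, generation 10: `#print axioms BuckmasterVicol2019_thm13_holds` = {`propext`, `Classical.choice`, `Quot.sound`}, both named facts of the proof file being theorems; [cite: BrueDeLellis2023, §2] and [cite: DeRosaTione2022, Thm. 1.2] read at page level; literature (Semantic Scholar and arXiv reachable; OpenAlex budget exhausted and the local index unavailable in this session; galaxy corpora: no relevant rows) under "Leray–Hopf non-uniqueness (hypodissipative, fractional, stochastic)", "vanishing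 viscosity … Leray / dissipative Euler", "anomalous dissipation … viscosity-independent force", "convex integration Navier–Stokes" (2025–2026), "wild / typical weak solutions Euler", "zeroth law": the one new realisation theorem is two-dimensional and instability-driven — on `ℝ²`, with ONE `ν`-independent force `f̄ ∈ L¹_t(L² ∩ W^{1,p})_x`, the unique Navier–Stokes solutions from data of the sharp size `‖u₀^ν‖_{Y_ν} ≈ ν^{κ_c}` converge along subsequences to non-unique, non-radial forced Euler solutions of Vishik's scenario, while `o(ν^{κ_c})` data select the radial one [cite: AlbrittonColomboMescolini2025, Thm. 1.1] (p. 3 of arXiv:2507.19257; barrier `ShearFlowViscositySelection`): same-force vanishing-viscosity realisation of NON-UNIQUE forced Euler flows is thereby in print for instability-generated flexibility in two dimensions (energy-conservative, Leray–Hopf and classical coinciding), and for no convex-integration flow ("it is an open question to understand which solutions can be seen in the vanishing viscosity limit", op. cit. p. 9); otherwise arXiv:2604.14100 (the 2D Euler equations generically well-posed in `L²`: genericity on the rigid side), [cite: CheskidovHou2026, Thm. 1.1], arXiv:2606.04218, arXiv:2606.15189, arXiv:2503.18041, [cite: LangeRehmeierSchenke2024, §1] — nothing reaching the Leray–Hopf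 class at `γ = 1` by convex integration, and no same-force (or vanishing-work, or `L¹_t L²`-convergent-force) Leray–Hopf, classical, steady or stationary-statistical realisation of a convex-integration flow. (re-audit 2026-08-17, generation 11, of the proof file) (cc) HYPOTHESIS SIDE: the printed reach of the weak realisation is "all the Hölder continuous weak solutions of the 3D Euler equations" (p. 4 of arXiv:1709.10033, before Thm. 1.3, re-read; [cite: BuckmasterVicol2019Annals, Thm. 1.3 and §1.2]; verbatim in [cite: BuckmasterVicol2020, Thm. 3.10], p. 14 of arXiv:1901.09023) — `u ∈ C^{β̄}_{t,x}`, exactly the hypothesis `HolderOnSpaceTime` of this fact — whereas the intermittent dissipative flows singled out in (q) as the targets least constrained by (e), (g), (i) are not shown to be bounded, let alone Hölder: `C([0,T]; H^β ∩ L^{(2-2β)/(1-2β)})`, `β < 1/2` [cite: NovackVicol2023, Thm. 1.1] (p. 4 of arXiv:2203.13115) and `C⁰([0,T]; B^β_{3,∞} ∩ L^{1/(1-3β)})`, `β < 1/3` [cite: GiriKwonNovack2026, Thm. 1.1] (p. 3 of arXiv:2305.18509); for them even the WEAK (Oseen-class) vanishing-viscosity realisation is unprinted — a routine but unwritten extension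 (the start (2.12)–(2.14) uses Hölder continuity only through an algebraic rate `‖(u⊗u)_ℓ - u_ℓ⊗u_ℓ‖_{L¹_{t,x}} ≲ ℓ^{2s}`, which `L^∞_t B^s_{2,∞}`, `s > 0`, together with the Lipschitz bound on `∂ₜu` in a negative Sobolev norm supplies, and through sup bounds `‖v_n‖_{C¹_{t,x}} ≲ ℓ^{-5/2}‖u‖_{L^∞_t L²}`, polynomial in `λ_n = ℓ^{-1}` as (2.3)–(2.5) require; the iteration fact `BuckmasterVicol2019_iterationFromLevel` then applies verbatim with `β`, `ε_R` re-chosen small, reading (3) of the proof file), so realisation items posed over intermittent classes must carry their own weak-realisation lemma, while the Hölder class `C⁰_t C^α_x` of crux VanishingViscosityRealizationV2 is covered ((o)); (dd) FORCE AXIS — WORK: the clauses "PAID by the work" of (x), the dividing line "the WORK functional" of (z) and "no … vanishing-work … realisation" of (bb) are TIME-RESOLVED statements (works `∫₀ᵗ(f_n,v_n)` on energy-rising intervals of typical flows; a literature census); for STRICTLY DISSIPATIVE flows a zero-NET-work corrector transmitting the full anomaly is free (elementary audit computation, not printed): let `u` be a zero-mean Hölder weak Euler flow on `T³` with `E(u(T))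 < E(u(0))` — or `τ`-periodic, driven by a smooth steady `f`, with period input `∮(f,u) > 0`, the Euler object of crux GloballyDissipativePeriodicEulerFlow without its defect-sign clause — and `u_ℓ` its space–time mollification, `R_ℓ = u_ℓ⊗u_ℓ - (u⊗u)_ℓ`; for EVERY `ν > 0`, `u_ℓ` is a classical, hence Leray–Hopf (`Torus.IsClassicalNSSolutionOn.isLerayHopfOn_of_convex`), solution of Navier–Stokes with viscosity `ν` and force `f + g_{ℓ,ν}`, `g_{ℓ,ν} = (f_ℓ - f) + div(R_ℓ - ν(∇u_ℓ + ∇u_ℓᵀ))`, and at the calibration `ν(ℓ) := P_ℓ/E_ℓ` — `P_ℓ = E(u_ℓ(0)) - E(u_ℓ(T))` (resp. `∮(f,u_ℓ)`, the period work of the steady force on `u_ℓ`), `E_ℓ = ∫₀ᵀ‖∇u_ℓ‖₂²` (resp. over a period) — the energy equality of the smooth flow `u_ℓ` makes the total (resp. period) work of `g_{ℓ,ν(ℓ)}` EXACTLY zero while the viscous dissipation is `ν(ℓ)E_ℓ = P_ℓ → E(u(0)) - E(u(T))` (resp. `→ ∮(f,u) > 0`); `ν(ℓ) → 0` as `ℓ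 → 0` because `E_ℓ → ∞` by lower semicontinuity, `u` not being in `L²_t Ḣ¹` (a bounded weak Euler flow in `L²_t Ḣ¹` lies in `L³_t B^{2/3}_{3,∞}` by the Littlewood–Paley interpolation `‖Δ_j u‖_{L³} ≤ ‖Δ_j u‖_{L^∞}^{1/3} ‖Δ_j u‖_{L²}^{2/3}`, above the Onsager class, and conserves energy — resp. obeys the forced balance, incompatible with periodicity and positive input — [cite: ConstantinETiti1994, p. 207]); and `g_{ℓ,ν(ℓ)} - (f_ℓ - f) = div G_ℓ` with `‖G_ℓ‖_{L²_{t,x}} ≤ ‖R_ℓ‖_{L²_{t,x}} + 2P_ℓ E_ℓ^{-1/2} → 0` (`‖R_ℓ‖_{C⁰} ≲ ℓ^{2α}[u]_α²`), i.e. the corrector vanishes in `L²_t H^{-1}` (in `C⁰_t W^{-1,∞}` as well when `E_ℓ ≈ ℓ^{2α-2}`, then `ν(ℓ)|∇u_ℓ| ≲ ℓ^{1-α}`), whereas each of its two parts does work `∓P_ℓ` on `u_ℓ` and so stays `≥ P_ℓ/‖u_ℓ‖_{L²_{t,x}}` in `L²_{t,x}`. Hence the summit's conclusion — global Leray–Hopf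 (indeed classical, `τ`-periodic) families with `ν_j → 0`, bounded mean energies and mean dissipations `∮(f,u_{ℓ_j})/τ ↛ 0` — driven by `f + g_j` with `g_j → 0` in `L²_t H^{-1}_x` of ZERO mean work follows from the Euler-side existence crux alone; on the force axis neither negative-norm smallness, nor vanishing net work, nor exact transmission of the designed anomaly is informative, the threshold being `L²`-strength convergence of the force — in print for `ν`-dependent forces converging in `C_t L²_x`, by a non-convex-integration construction [cite: Cheskidov2023, Thm. 1.3] (`Literature.Analysis.FluidPDE.cheskidov_time_periodic_anomaly`) — and, for a convex-integration flow, the SAME force, i.e. the `L²`-absorption of the explicit corrector `g_{ℓ,ν(ℓ)}` at the single scale `ℓ` by a perturbation vanishing in `L³_{t,x}` (cruxes VanishingViscosityRealizationV2, SubviscousDefectAbsorption; (s), last paragraph) — recorded as a sharpened idea-card seed in the audit notes; (ee) tree and literature re-verified 2026-08-17, generation 11: `#print axioms BuckmasterVicol2019_thm13_holds` = {`propext`, `Classical.choice`, `Quot.sound`} on the renamed tree (D-0022; both named facts of the proof file theorems), the accepted `Torus.IsLerayHopfOn` re-read (both energy inequalities, `L²_t H¹`, weak continuity: the notion of the companions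 is the summit's) and `Literature.Turb.ZerothLaw` (existential over a SEQUENCE `ν_j → 0`, so sequential realisation as in Thm. 1.3 is the right shape); literature (arXiv, the local index and the citation frontier of the summit's root set since 2025 reachable; OpenAlex budget exhausted, Semantic Scholar rate-limited; galaxy corpora: no relevant rows) under "Leray–Hopf non-uniqueness / nonuniqueness Navier–Stokes" (2025–), "convex integration Navier–Stokes" (2025–2026), "hypodissipative / fractional … Leray–Hopf", "vanishing viscosity … Euler dissipative" (2025–), "anomalous dissipation", "Onsager", "non-uniqueness Navier–Stokes", "energy inequality convex integration" (2026): the new entries are a NUMERICAL realisability exclusion — discretely energy-conserving exterior-calculus schemes converge to no energy-dissipating Euler flow at any Hölder regularity [cite: Korn2026, abstract] (arXiv:2605.13048, p. 1; discrete conservation, not viscosity) —, `L^r` convex integration for geophysical models (arXiv:2606.12192), admissible compressible non-uniqueness (arXiv:2606.14308) and the swirl-free Leray–Hopf programme [cite: IonescuJiaPalasek2026, §1.1]; the forced 4/5-law families of Hofmanová–Pappalettera–Zhu–Zhu (arXiv:2304.14470, §2) are those of [cite: BCCDS2024, Thm. 1.1], not convex-integration flows; the "anomalous work" of [cite: CheskidovLuo2021,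 §1] is a fixed-`ν` Littlewood–Paley defect for forces in `L^{2-ε}_t H^{-1}` (op. cit. Thms. 1.4, 1.6, pp. 5–6 of arXiv:1910.04204), unrelated to the `ν → 0` work of (dd); and the Navier–Stokes INEQUALITY — the energy class with both energy inequalities and the local one, the equation relaxed by a sign-constrained defect — is flexible with arbitrary non-increasing energy profiles for all `ν ∈ [0,ν₀]` [cite: Ozanski2018, Thm. 1.3] (CMP 374 (2020); p. 4 of arXiv:1809.02109), consistent with (k), (aa): at `γ = 1` the obstruction is the EQUATION in the energy class, not the inequalities; nothing reaching the Leray–Hopf class at `γ = 1` by convex integration, and no same-force Leray–Hopf, classical, steady or stationary-statistical realisation of a convex-integration flow. (re-audit 2026-08-17, generation 12, of the proof file) (ff) SELECTION SIDE — read at page level for an exclusion this block might be missing: Onsager's ‘ideal turbulence’ programme records the same gap from the physical side — "None of the weak Euler solutions discussed so far are obtained by taking infinite-Reynolds-number limits of the solutions of fluid equations valid at dissipation-range scales, such as the incompressible Navier–Stokes equation", the Euler solutions of physical relevance "must possess very special properties not shared by general weak Euler solutions, including those manufactured by convex integration methods", and the SELECTION problem — conditions characterising a priori the Euler solutions obtained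 in the inviscid limit — is open [cite: Eyink2024, §3.2.3] (p. 42 of J. Fluid Mech. 988, P1); the selection conditions proposed in print are conjectural (the martingale property of circulations) or already catalogued (the local energy inequality of (e)), and "the Euler solutions constructed by current convex integration methods have unphysical features" is an expectation, not a theorem [cite: Eyink2024, §3.2.2] (p. 40); likewise "convex integration solutions and classical Leray weak solutions still remain potentially disjoint classes" [cite: FlandoliRehmeier2024, §2.3]. The predictability-loss / Eulerian spontaneous-stochasticity picture invoked there — dissipation-scale errors reach the largest scales in a few large-eddy turnover times [cite: BandakEtAl2024], stochastic inviscid limits of singular shear layers [cite: ThalabardBecMailybaev2020], so that the limit `ν → 0` from one datum, or from generically perturbed data with the perturbation removed together with `ν`, is expected to be a non-degenerate probability measure on weak Euler flows rather than one flow — concerns the SAME-DATUM (or generic-data) limit of the Leray–Hopf (or Landau–Lifshitz) evolution; it is no obstruction to the realisation barred here, which — like `ZerothLaw` (`∃ u₀ⱼ`) and crux VanishingViscosityRealizationV2 — is EXISTENTIAL over the data (fine-tuned `ν`-dependent data allowed) and over the Leray–Hopf solutions at each `ν_j`, i.e. a SHADOWING statement for the Navier–Stokes flow along the mollified convex-integration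 pseudo-orbit `u_ℓ`, whose residual `div(R_ℓ - ν∇u_ℓ)` vanishes only in negative norms ((x), (dd), (gg)), with the initial condition free; and at fixed `ν > 0` a Leray–Hopf solution is not determined by datum and force anyway [cite: AlbrittonBrueColombo2022AnnMath, Thm. 1.2] [cite: HouWangYang2025, §1]; from SMOOTH data, on the other hand, every `C⁰_t L²` limit of Leray–Hopf solutions with `L²`-convergent data is the classical Euler flow while the latter exists (relative energy; barriers `MeasureValuedWeakStrong` — `BrenierDeLellisSzekelyhidi2011_cor1` — and `ClassicalEulerLimit`), so a dissipative flow can be realised only from rough slices or beyond the classical lifespan of its datum; on `T³` the printed exclusions of dissipative convex-integration flows from Leray–Hopf realisation therefore remain exactly the energy ceiling (e), the budget (g), the resolution constraint (i) and the regular-limit barriers (audit reading, not printed); (gg) FORCE AXIS ON THE SOBOLEV SCALE (elementary, not printed; sharpens the `W^{-1,∞}` / `L²_t H^{-1}` statements of (x), (dd)): for `u ∈ C^{β̄}_{t,x}` and its space–time mollification `u_ℓ`, `‖R_ℓ‖_{C⁰} ≲ ℓ^{2β̄}` and `‖∇R_ℓ‖_{C⁰} ≲ ℓ^{2β̄-1}`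 [cite: BuckmasterVicol2019Annals, §2.5 (2.12)–(2.13)] [cite: ConstantinETiti1994, p. 207] with `‖u_ℓ‖_{Ḣ^m} ≲ ℓ^{β̄-m}` (`m ≥ 1`) give, by interpolation on `T³`, `sup_t ‖div R_ℓ‖_{H^{-s}} ≲ ℓ^{2β̄-1+s}` and `sup_t ν‖Δu_ℓ‖_{H^{-s}} ≲ ν ℓ^{β̄-2+s}` for `0 ≤ s ≤ 1`; hence the force `f^ν = div(R_ℓ - ν∇u_ℓ)` of the classical Leray–Hopf approximant `u_ℓ` of (x) vanishes in `C⁰_t H^{-s}_x` for every `s > 1 - β̄` at `ℓ = ν`, and for every `s > 1 - 2β̄` at the calibration `ℓ = ν^{1/(1+β̄)}` of [cite: BuckmasterVicol2020, Rem. 6.4] (both parts then of the common size `ℓ^{2β̄-1+s}`; down to `H^{-1/3-}` as `β̄ ↑ 1/3`, the work still diverging as in (c), (i)); so Leray–Hopf — indeed classical — realisation of every zero-mean Hölder weak Euler flow is FREE with forces vanishing in `C⁰_t H^{-s}_x`, `s > 1 - 2β̄`, realisation items are vacuous up to that strength, informative force control begins at the latest at `s = 1 - 2β̄` and includes `L²_x`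 ((x): works pass to the limit), and between `C⁰_t H^{-(1-2β̄)}` and `L¹_t L²_x` nothing is printed either way; tree and literature re-verified 2026-08-17, generation 12: `#print axioms BuckmasterVicol2019_thm13_holds` = {`propext`, `Classical.choice`, `Quot.sound`} (both named facts of the proof file theorems; `Literature.Turb.ZerothLaw` re-read: `∃ f` smooth steady, `∃ νⱼ → 0`, `∃ u₀ⱼ`, global Leray–Hopf `uⱼ`, bounded mean energies, mean dissipations `≥ ε > 0` — existential over data, as used in (ff)); literature (arXiv, zbMATH and the local index reachable; OpenAlex budget exhausted, Semantic Scholar rate-limited after one query; galaxy corpora: no relevant rows) under "Leray–Hopf non-uniqueness" (zbMATH 2023–, arXiv 2026), "hypodissipative Navier–Stokes" (2022–: the deterministic three-dimensional Leray–Hopf reach of `evasions_known` unchanged at `γ < 1/3`; the two-dimensional forced hypodissipative Leray non-uniqueness is instability-driven [cite: AlbrittonColombo2023, Thm. 1.1]), "convex integration Navier–Stokes / Euler" (2026), "anomalous dissipation Navier–Stokes" (2026), "vanishing viscosity Euler weak solutions" (2026), "spontaneous stochasticity" (2024–): renormalisation-group and measure-theoretic formulations of spontaneous stochasticity (arXiv:2602.24221,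 arXiv:2607.16328), spontaneous stochasticity in the Armstrong–Vicol scalar (arXiv:2509.15683), failure of the local least-action selection criterion for compressible convex-integration fans (arXiv:2606.16685), low-Mach and geophysical convex integration (arXiv:2601.19744, arXiv:2606.12192), [cite: CheskidovHou2026, Thm. 1.1] — nothing reaching the Leray–Hopf class at `γ = 1` by convex integration, no same-force (or `L¹_t L²`-convergent-force) Leray–Hopf, classical, steady or stationary-statistical realisation of a convex-integration flow, and no printed selection principle excluding one on `T³`. (re-audit 2026-08-17, generation 15, of the proof file) (hh) THE CONVERSE EMBEDDING IS FREE — what `blocks:` leaves open is one-directional (elementary from the printed h-principle; not printed as a statement about Navier–Stokes): a smooth solution `(v, p)` of the unforced Navier–Stokes equations with viscosity `ν` on `T³ × [0,T]` is a smooth STRICT SUBSOLUTION of the Euler equations in the sense of [cite: BDLSV2019, Def. 1.2] — `∂ₜv + div(v ⊗ v) + ∇(p - c) = -div R̄` with `R̄ := c Id - ν(∇v + ∇vᵀ)`, positive definite for every smooth `c > ν λ_max(∇v + ∇vᵀ)` (a nonnegative function, the symmetric gradient being trace-free because `div v = 0`; `div R̄ = ∇c - νΔv`), e.g. `ν λ_max(∇v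 + ∇vᵀ) < c ≤ 2ν|∇v| + η` — the viscous stress read as a Reynolds stress, the reverse of the reading of [cite: BuckmasterVicol2020, Rem. 6.4] behind (c) and (x); hence [cite: BDLSV2019, Thm. 1.3] supplies, for every `β < 1/3`, weak Euler solutions `ũ_k ∈ C^β(T³ × [0,T])` with `ũ_k ⇀* v` uniformly in time and `‖ũ_k(t)‖₂² = ‖v(t)‖₂² + 3∫c(t,·)` for all `t`, so that `lim_k sup_t ‖ũ_k(t) - v(t)‖₂² = 3 sup_t ∫c(t,·) ≤ 6ν sup_t ‖∇v(t)‖_{L¹} + 3η ≤ 6ν^{1/2} sup_t ε(t)^{1/2} + 3η`, `ε(t) = ν‖∇v(t)‖₂²` the instantaneous dissipation rate, and in `L²_{t,x}` unconditionally along bounded-energy families, `lim_k ∫₀ᵀ‖ũ_k - v‖₂² ≤ 6(νT)^{1/2}(ν∫₀ᵀ‖∇v‖₂²)^{1/2} + 3ηT` (bounded weak Euler flows agreeing with `v` at `t = 0, T` are given instead by the subsolution criterion [cite: DeLellisSzekelyhidi2010, Prop. 2] with `ē = ½|v|² + (3/2)ν|∇v + ∇vᵀ| + η`, printed on `ℝⁿ`,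 on `T^d` in the form [cite: Szekelyhidi2011, Thm. 1.3]; a smooth force `f` rides with the subsolution's linear system in either construction — routine, not printed verbatim; a Leray–Hopf `v` qualifies after space–time mollification, which adds the positive semidefinite commutator stress `(v ⊗ v)_ℓ - v_ℓ ⊗ v_ℓ` of vanishing trace integral), and, for classical `v`, by this energy identity with the energy equality of `v` the anomalous dissipation of every such shadow on `[s,t] ⊆ [0,T]` is `½‖ũ(s)‖₂² - ½‖ũ(t)‖₂² + ∫ₛᵗ(f,ũ) = ν∫ₛᵗ‖∇v‖₂² + O(‖f‖₂ (t-s) sup_τ‖ũ - v‖₂ + ν sup_τ‖∇v(τ)‖_{L¹} + η)`. So at viscosity `ν` EVERY classical flow is shadowed in `C⁰_t L²`, to every accuracy `> (6ν sup_t‖∇v(t)‖_{L¹})^{1/2}`, by exact Onsager-critical (`C^{1/3-}`, with `ν`-dependent Hölder norms — no compactness is produced) convex-integration Euler flows with the same force, dissipating anomalously exactly what `v` dissipates viscously; consequences for the scope of `blocks:`: (1) along every bounded-energy vanishing-viscosity family of classical witnesses of the summit with `ν_j sup_t ε_j(t) → 0` — dissipation rates `o(ν_j⁻¹)` uniformly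 in time; for steady states `ε_j = (f,u_j) ≤ ‖f‖₂ sup_j‖u_j‖₂` — the bare Euler-side objects of Euler-limit routes (exact weak Euler flows with the steady force, bounded energy and anomalous dissipation `½‖ũ(s)‖₂² - ½‖ũ(t)‖₂² + ∫ₛᵗ(f,ũ)` equal to the witnesses' viscous dissipation up to `o(1)`, Hölder class included, window by window) come WITH the witnesses, so an Euler-side existence crux (route EulerLimit) is load-bearing only through the extra structure it prescribes — ONE `ν`-independent flow, `τ`-periodicity, `ν`-uniform Hölder bounds, `D ≥ 0` — never through bare existence (the shadows of steady witnesses so obtained are time-dependent; steady shadows, standing cascades `L²`-near steady states, would need the stationary h-principle of (s) from general strict stationary subsolutions [cite: ChoffrutSzekelyhidi2014, Thm. 1], whose printed start is an exact smooth steady flow); (2) realisation in the FAMILY sense — each witness within `o(1)` in `C⁰_t L²` of SOME exact dissipative Euler flow with the same force — is equivalent, window by window and for such families, to the dissipation clause it was meant to explain, and has no decomposition value; (3) the open problem of `blocks:` is exactly the PRESCRIBED direction — Leray–Hopf or classical flows within `o(1)` of one given convex-integration flow, i.e. realisation with precompactness of the family in `C⁰_t L²` (equivalently a dissipation anomaly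 of classical solutions with strong precompactness, cf. [cite: DrivasEyink2019, Thm. 2]) — on which alone the constraints (e), (g), (i) bear; tree and literature re-verified 2026-08-17, generation 15: `BuckmasterVicol2019_thm13_holds` closes the fact with axioms `propext`, `Classical.choice`, `Quot.sound` (both named facts of the proof file theorems); literature (arXiv, zbMATH, Crossref and the local index reachable; OpenAlex budget exhausted, Semantic Scholar rate-limited; galaxy corpora: no relevant rows) under "Leray–Hopf non-uniqueness / convex integration Navier–Stokes" (2025–2026), "vanishing viscosity … convex integration / Leray–Hopf", "anomalous dissipation Navier–Stokes" (2026), "inviscid limit weak solutions Euler" (2026), "intermittent convex integration" (2025–), and the 2026 citers of [cite: BuckmasterVicol2019Annals, Thm. 1.3] and of [cite: BrueDeLellis2023, §2]: sharp non-uniqueness of mild solutions in critical Besov classes [cite: Fujii2026, Thm. 1.2], the swirl-free Leray–Hopf programme (arXiv:2606.07501), entropy-inadmissible vanishing-viscosity limits of passive scalars [cite: HuysmansTiti2025, Thm. 6.7], stability of the `2½`-dimensional anomaly (arXiv:2605.18126) — nothing reaching the Leray–Hopf class at `γ = 1` by convex integration and no same-force (or `L¹_t L²`-convergent-force) Leray–Hopf,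 classical, steady or stationary-statistical realisation of a convex-integration flow.
- status: established (Thm. 1.3 is a theorem; the Leray–Hopf realisation is a documented open problem) [cite: BuckmasterVicol2019Annals, Thm. 1.3 and §1.2]; re-audited 2026-08-15 (refuter barrier audit: confirmed for `γ = 1`, lines `because`/`evasions_known`/`scope_caveats` sharpened) [cite: CheskidovPeng2025, §1]; re-audited 2026-08-17 (refuter barrier audit of the proof file: confirmed — transcription page-checked, both named facts discharged — and narrowed for energy-gaining flows: `ConvexIntegrationNonLerayEnergyCeilingNarrow`) [cite: BuckmasterVicol2019Annals, §1.2]; re-audited 2026-08-17, generation 2 (confirmed to 2026-07 for `γ = 1` on `T³`, and narrowed by the dissipation budget `ConvexIntegrationNonLerayDissipationBudgetNarrow`, caveats (g)–(h)) [cite: CheskidovPeng2025, §1 and Rem. 1.5]; re-audited 2026-08-17, generation 3 (confirmed for `γ = 1` on `T³` to 2026-08, and narrowed by the resolution budget `ConvexIntegrationNonLerayResolutionNarrow` — Rem. 6.4 as a theorem about every Leray–Hopf realisation — caveats (i)–(j)) [cite: BuckmasterVicol2020, Rem. 6.4]; re-audited 2026-08-17, generation 4 (confirmed: the Navier–Stokes-side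 frontier re-read at page level — `L²_t H¹` with the a.e.-time energy inequality is the precise unreached class, scaling-supercritical, posed as open by the technique's authors — no evasion to 2026-08, no new narrowing; caveats (k)–(l)) [cite: CheskidovZengZhang2025, p. 2] [cite: CheskidovLuo2022, Thm. 1.7]; re-audited 2026-08-17, generation 5 (confirmed: the fact re-verified as a kernel theorem, technique-class coverage and the hypothesis class re-checked at page level, caveat (l) proved as `weakNS_realisation_LpLinfty`; caveats (m)–(r)) [cite: Dai2021HallMHD, Thms. 1.1–1.2] [cite: ColomboDeRosaSorella2022, Thm. 1.1]; re-audited 2026-08-17, generation 6 (confirmed: the fact re-verified as a kernel theorem and the literature to 2026-08 unchanged; scope bounded on the summit side — the block's clauses are Cauchy-problem clauses, void for steady and smooth-designed witnesses, whose Euler-side objects the forced stationary h-principle supplies as a tree theorem and whose same-force steady realisation is open in print, rigid only in two dimensions; caveats (s)–(t)) [cite: ChoffrutSzekelyhidi2014, Thm. 1] [cite: ConstantinTarfuleaVicol2013, p. 3] [cite: Luo2019, Thm. 1.4]; re-audited 2026-08-17, generation 7 (confirmed: the fact re-verified as a kernel theorem; `evasions_known` reworded at page level for [cite: Derosa2018,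 Thm. 1.3], existential in the Euler flow; the statistically stationary mode of the technique's Navier–Stokes reach recorded — the long-time-statistics analogue of Thm. 1.3, equally non-Leray — together with the late-time rigidity of Leray–Hopf witnesses for the summit's `limsup` functionals; literature to 2026-08 unchanged; caveats (u)–(w)) [cite: HofmanovaZhuZhu2022Ergodicity, §5 Thm. 5.1] [cite: Sohr2001, Ch. V Thm. 1.5.1]; re-audited 2026-08-17, generation 9 (confirmed for `γ = 1` — the `L²_t H¹` frontier of (k) re-read at page level against [cite: LiQuZengZhang2022, Thm. 1.2], literature to 2026-08 unchanged — and narrowed on the force axis: Leray–Hopf, indeed classical, realisation of every Hölder Euler flow is free with `C⁰_t W^{-1,∞}`-vanishing `ν`-dependent forces, theorems `holderEuler_lerayHopf_realisation_smallForce` / `BuckmasterVicol2019_thm13_lerayHopf_smallForce` of the sibling file `ConvexIntegrationNonLerayForceTopology`, so the open realisation is the same-force / `L¹_t L²`-force one; caveats (x)–(y)) [cite: BuckmasterVicol2019Annals, §2.5 (2.12)–(2.15)] [cite: BuckmasterVicol2020, Rem. 6.4]; re-audited 2026-08-17, generation 10 (confirmed: the fact re-verified as a kernel theorem; technique-class coverage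 re-derived from the schemes' bookkeeping — the energy class `L²_t Ḣ¹` is pinned half a derivative beyond the `H^{1/2-}` cap of one-step cascades, caveat (aa); the live class of the open realisation is MEAGRE — the Baire-typical flexible flow has energy of unbounded variation on every interval and is excluded by (e) and (g), caveat (z); literature to 2026-08 unchanged for convex-integration flows, the one new same-force realisation of non-unique Euler flows being two-dimensional and instability-driven, caveat (bb)) [cite: DeRosaTione2022, Thm. 1.2] [cite: AlbrittonColomboMescolini2025, Thm. 1.1]; re-audited 2026-08-17, generation 11 (confirmed: the fact re-verified as a kernel theorem on the renamed tree; scope sharpened on the hypothesis side — the printed weak realisation is Hölder-only, caveat (cc) — and on the force axis — zero-net-work correctors transmitting the full anomaly are free, caveat (dd); literature to 2026-08 unchanged, caveat (ee)) [cite: BuckmasterVicol2019Annals, §1.2] [cite: NovackVicol2023, Thm. 1.1]; re-audited 2026-08-17, generation 12 (confirmed: the fact re-verified as a kernel theorem; the selection side of the inviscid limit read at page level — no printed selection principle excludes a dissipative convex-integration flow from Leray–Hopf realisation on `T³` beyond (e), (g), (i) and the regular-limit barriers, spontaneous stochasticity bearing on the same-datum or generic-data limit only, caveat (ff); the free realisation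 of (x) quantified on the Sobolev force scale, `C⁰_t H^{-s}_x` for `s > 1 - 2β̄`, caveat (gg); literature to 2026-08 unchanged) [cite: Eyink2024, §3.2.3] [cite: FlandoliRehmeier2024, §2.3]; re-audited 2026-08-17, generation 13 (confirmed: tree unchanged — the fact a kernel theorem, both named facts of the proof file theorems; caveat (y) corrected at page level — the regime `𝒜₂` of [cite: LiQuZengZhang2022, Thm. 1.2] is sufficient, not exhaustive, and the `L²_{t,x}`-criticality of space–time convex integration behind (aa) is printed there, p. 7; literature unchanged hours after generation 12 (arXiv reachable; local index, OpenAlex, Semantic Scholar, zbMATH degraded); no new narrowing and no new card seed — the constraints a Leray–Hopf realisation must meet remain (e), (g), (i), the free realisations (l)/(p), (x), (dd), (gg), and the scope bounds (s), (u)–(v), (z), (cc), (ff): the audit of this block is saturated) [cite: LiQuZengZhang2022, Thm. 1.2 and p. 7]; re-audited 2026-08-17, generation 15 (confirmed: tree unchanged — the fact a kernel theorem, both named facts of the proof file theorems — and the literature unchanged; scope sharpened by the free CONVERSE embedding, caveat (hh): a classical Navier–Stokes flow is a smooth strict Euler subsolution with the viscous stress as Reynolds stress, hence `o(1)`-shadowed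 in `C⁰_t L²` by exact `C^{1/3-}` convex-integration flows with the same force and equal dissipation, so the open realisation of `blocks:` is the prescribed, compact direction only, family-sense realisation is a restatement of the dissipation clause, and bare Euler-side existence cruxes are never load-bearing; no new narrowing fact and no card seed) [cite: BDLSV2019, Def. 1.2 and Thm. 1.3] [cite: DeLellisSzekelyhidi2010, Prop. 2] -/
def BuckmasterVicol2019_thm13 : Prop :=
  ∀ (T : ℝ) (_hT : 0 < T) (β' : ℝ≥0) (_hβ' : 0 < β') (u : ℝ → 𝕋³ → E³)
    (_hHolder : Literature.Analysis.FunctionSpaces.HolderOnSpaceTime β' (4 * T) (fun t => u (t - 2 * T)))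
    (_hEuler : Literature.Analysis.FunctionSpaces.Torus.IsWeakEulerSolutionOn (4 * T) (fun t => u (t - 2 * T)))
    (_hmean : ∀ t, Literature.Analysis.FunctionSpaces.Torus.HasZeroMean (u t)),
    ∃ (β : ℝ) (ν : ℕ → ℝ) (v : ℕ → ℝ → 𝕋³ → E³),
      0 < β ∧ (∀ n, 0 < ν n) ∧ Tendsto ν atTop (𝓝 0) ∧
      (∀ n, Literature.Analysis.FunctionSpaces.Torus.IsWeakNSSolutionOn T (ν n) (v n)) ∧ (∀ n t, Literature.Analysis.FunctionSpaces.Torus.HasZeroMean (v n t)) ∧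
      (∀ n, Literature.Analysis.FunctionSpaces.Torus.ContinuousInSobolevOn (Icc 0 T) β
        (fun t => Literature.Analysis.FunctionSpaces.EuclideanSpace.complexify ∘ v n t)) ∧
      (∃ M : ℝ≥0, ∀ n, ∀ t ∈ Icc 0 T,
        Literature.Analysis.FunctionSpaces.Torus.eSobolevNorm β (Literature.Analysis.FunctionSpaces.EuclideanSpace.complexify ∘ v n t) ≤ M) ∧
      Tendsto (fun n => ⨆ t ∈ Icc 0 T, eLpNorm (v n t - u t) 2 volume) atTop (𝓝 0)

end Literature.Barriers.AnomalousDissipation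

end
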